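import Mathlib
import HarnessLib
import HarnessLib.Audit
import Summits.RiemannHypothesis.Statement
import Literature.NumberTheory.LFunctions.RiemannXi
import Literature.Analysis.Complex.DeBruijnUniversalFactors
import Summits.RiemannHypothesis.RiemannHypothesis.Theorems.Splittings.JensenEdgeLawPoly
import Summits.RiemannHypothesis.RiemannHypothesis.Theorems.Splittings.JensenSignLawCount
import Literature.NumberTheory.LFunctions.RHWave0
import Literature.NumberTheory.LFunctions.RiemannXiProofs
import Literature.NumberTheory.LFunctions.GeneralizedRH
import Literature.NumberTheory.LFunctions.ZetaRealAxis
import HarnessLib.Audit.Status.Attr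

/-!
Route: EarlyAppointments

# Route EarlyAppointments (W-07 re-glue, closes_v7_421 shape, residual shrink #1, RESTATE-α rev 11,
κ = ½) — off-line zeros of ζ far from the line must LAND EARLY: a tilted Jensen-disc descent books a
non-Laguerre extremum of some Re Ξ^(k), k ≤ 2/s(γ)+(1/2/s(γ))²+B+1+(B+1)/2, inside the window |x−γ|
< (k+3)·67.5

**Thesis X (words).** Write Ξ(z) = ξ(1/2+iz) (`Literature.NumberTheory.LFunctions.riemannXiUpper`),
s(γ) = 2π/log(γ/2π) the local mean spacing, Btb γ = ⌈2·W₁(2γ)+1/100⌉₊ (W₁(T) = 0.1035 log T + 0.2395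
log log T + 4.92, the Trudgian–HSW window constant) and T₁ = T_PT = 3 000 175 332 800
(Platt–Trudgian height). It suffices to show the conjunction of FIVE items: (1) `HeightPT` — RH up
to T₁ (cited fact); (2) `TiltedLandingLaw421RT` — the RH-FREE ENGINE at (A₀,C₀,D₀) = (4,2,1) WITH
VOID CHARGE (B+1)/2 (C4 PACKET rev 6 `TiltedLandingLaw5 4 2 1`, re-typed after the K1/T1 model kills
of the (4,2) law; RESTATE-α rev 11, director-rh (CA388): the rev-7–10 text `TiltedLandingLaw421` is
numerically false as typed on legal right-void comb designs — C2 RIDER-94 c40/c48/c56/c64, margins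
−1/−3/−4/−5, replicated by desk engine 3 and critic engine 2c, slope J2 ≈ c+9+c/8 — and is kept
byte-identical as an ASIDE): for every real entire f of order < 2 with zeros in a strip |Im| ≤ Hs, a
non-real zero pair on a column Re = x₀ at height ≤ hmax, zero budgets B on columns/half-slabs at
scales s ≤ r ≤ R and a level-0 remainder ≤ η/s for f′/f minus its local polar part (2s ≤ hmax, 2hmax
≤ R, 3hmax < R, 2Hs ≤ R, 2η ≤ 1) there is a non-Laguerre critical point of Re f^(k) on ℝ (g′ = 0 ≠
g, g·g″ ≥ 0) for some k ≤ 4hmax/s + (Hs/s)² + B + 1 + (B+1)/2 within (k+3)·R/2 of x₀ (the added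
(B+1)/2 = C4 ADD-1 (α) void charge with coefficient κ = ½ — twice V/(4s), V ≤ (1+B)·s the longest
zero-free real interval adjacent to the column under the typed half-slab budgets — selected by the
(CA390)(B) safety-2 rule after the (CA389) geometry sweep found sup (J2 − typed)/(B+1) ≥ ⅛ on legal
designs); (3) `Remainder0Xi` (ρ2) — the RH-free level-0 remainder bound for Ξ at η = 1/2 on the
boxes |Re w − γ| ≤ 67.5, |Im w| ≤ 1/2, γ > T₁; (4) `XiLevel0Inputs4` — Ξ has order < 2 and obeys the
T-B column/half-slab budgets with B = Btb γ, R = 135 (RH-free; CLOSED proved,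
`xiLevel0Inputs4_holds` p723601); (5) `WindowRows421R` — the DECLARED RESIDUAL (RH-implied),
RESIDUAL SHRINK #1 (director (CA186)(2); C6 rh-idea-4 g18 kernel bfeba44d, C3 g21 ad492a6e) with the
rev-11 depth: windowed Laguerre rows ONLY — no NL event of Re Ξ^(k), k ≤ D_R(γ) =
2/s(γ)+(1/2/s(γ))²+Btb γ+1+(Btb γ+1)/2, |x−γ| < (k+3)·67.5, γ > T₁ (the rev-10 text `WindowRows421`,
depth D(γ) without the last term, is kept as an ASIDE); the former near-line landing conjunct (a) of
`WindowedSignPatternAllBands421` (revs 7–9) is proved redundant (the engine serves δ < 2s(γ) at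
frame height hmax = 2s(γ)).

Lean: `HeightPT ∧ TiltedLandingLaw421RT ∧ Remainder0Xi ∧ XiLevel0Inputs4 ∧ WindowRows421R` (the five
route decls; deciding theorem `closes : HeightPT → WindowRows421R → TiltedLandingLaw421RT →
Remainder0Xi → XiLevel0Inputs4 → Summit.RiemannHypothesis`, certified rc 0, sorry-free).

## Assembly
An off-line zero ζ(1/2+δ+iγ)=0, δ>0 (WLOG γ>0 by conjugation, δ>0 by s ↦ 1−s; δ < 1/2 by Mathlib's
non-vanishing on Re s ≥ 1) is excluded in two regimes: γ ≤ T₁ by HeightPT; γ > T₁ (every 0 < δ <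
1/2, no δ-threshold) by the engine: Ξ(γ − iδ) = 0 is the pair (dictionary
`riemannXi_eq_zero_iff_holds`), hmax = max-type choice (δ if 2s(γ) ≤ δ, else 2s(γ) — the engine's
clause 2s ≤ hmax binds the FRAME height, not the pair), s = s(γ), R = 135 (so 3·hmax < 135), Hs =
1/2 (tree: |Im u| < 1/2 for zeros of Ξ), B = Btb γ, η = 1/2, budgets from XiLevel0Inputs4, remainder
from Remainder0Xi restricted to |Im w| ≤ hmax ≤ 1/2 (2s(γ) ≤ 1/2 ⟸ log(γ/2π) > 8π ⟸ γ > T₁); the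
engine's NL event has depth ≤ 4·hmax/s+(1/2/s)²+B+1+(B+1)/2 ≤ D_R(γ) (4δ/s ≤ 2/s as δ ≤ 1/2; 8 ≤
2/s(γ) ⟸ the same γ > T₁; the void-charge term is identical on both sides) and abscissa within
(k+3)·67.5 of γ, contradicting the rows residual WindowRows421R. Then
`riemannHypothesis_iff_strip_holds` turns 'no off-line zero' into Mathlib's `RiemannHypothesis`. RH
is NOT proved: TiltedLandingLaw421RT and Remainder0Xi are open and the residual WindowRows421R is
RH-strength; the (4,2) text of TiltedLandingLaw42 (stmt-24729, route revs 4–6, git 346d2fb2) is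
false as typed (K1/T1) and was RESTATED (rev 7); the residual (a)∧(b) of revs 7–9 (stmt-24775) is
replaced by its conjunct (b) (residual shrink #1, rev 10); the (4,2,1) text TiltedLandingLaw421
(stmt-24774, revs 7–10, git 408d1131) is numerically false as typed (RIDER-94 ×2, no kernel
¬-theorem) and is RESTATED as TiltedLandingLaw421R with the residual slaved to it (RESTATE-α, rev
11); (rev 13, RESTATE-β′, PRIMARY (57ck) YES 2026-08-31T22:25:39Z, HOME/INBOX l.24472; execution
order director-rh (CA1164) rh-split STATUS l.10425) TiltedLandingLaw421R is RE-TYPED as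
TiltedLandingLaw421RT = the same text with ONE thin-lid frame binder `2 * (Hs + hmax) ≤ R` (BLOCK
168 E1′, the binder the landed thin sink consumer #1305 takes; numerically warranted by kit j344858
«thincert», 2 002/2 002 regions interval-certified); TiltedLandingLaw421R stays in the file
byte-identical as an aside and implies the new item by dropping the binder.

Rationale: WHY THIS LINE. Card early-appointments-landing-law (Pólya–Wiman theory of real entire functions
[CravenCsordasSmith1987, KiKim2000], the zero/critical-point pairing displacement of
random-polynomial theory [KabluchkoSeidel2019] run deterministically, explicit zero counting for ζ
[Trudgian2014, PlattTrudgian2015, HSW], Laguerre inequalities [CsordasNorfolkVarga1986,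
CsordasVarga1988]). Differentiation is the one Laguerre–Pólya-preserving, arithmetic-free, LOCAL and
monotone flow, so every off-line zero has a landing order; the W-07 programme (C1–C6, director
CA146–CA166) priced it with explicit constants and split the summit into an RH-FREE part — engine
(TiltedLandingLaw421RT since rev 13 = TiltedLandingLaw421R of revs 11–12 on thin-lid frames
2·(Hs+hmax) ≤ R; TiltedLandingLaw421 revs 7–10) + Ξ-inputs (XiLevel0Inputs4, PROVED:
`xiLevel0Inputs4_holds` p723601) + level-0 remainder (Remainder0Xi, ρ2) — which handles every zero
at distance ≥ 2 mean spacings from the line above T_PT, and a DECLARED RH-implied residual (since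
rev 10: the windowed Laguerre rows only — the engine has no δ-threshold above T_PT, C6 g18
`closes_rows` bfeba44d). Rev 421 (C4 PACKET rev 6, 37365a4dde272ebf): the (4,2) law died in the
model (K1: a comb-starved tilted pair (z²+40²)e^{0.44z} lands at level ⌈c²h²⌉−1 = 309 > 288,
QUADRATIC in h/s; T1: a held pair lands outside R/2+√k·hmax) — the re-type adds the de Bruijn
heat-flow depth term (Hs/s)² and the Jensen drift window (k+3)·R/2 and the frame clause 3hmax < R;
the residual's literals are slaved to it. Rev 11 (RESTATE-α, director-rh (CA388), 2026-08-30): the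
(4,2,1) depth died NUMERICALLY on LEGAL right-void comb designs (C2 g38 RIDER-94: f =
sin(πz)·∏(z+3+0.02j)·(z²+4)/∏(z−t), a held pair at the corner 2s = hmax = Hs = 2, η = 1/2, fed by a
dense cluster across a legal void; c40·D3·L33 lands at level 50 > 49, c48·D3·L41 at 60 > 57; desk
engine 3 and critic engine 2c replicate digit-for-digit; slope c40…c96 margins −1/−3/−4/−5/−7/−8, J2
≈ c+9+c/8, i.e. NON-ADDITIVE) — the re-type charges the void: + (B+1)/2 levels (C4 ADD-1 (α) at
coefficient κ = ½: twice V/(4s), V ≤ (1+B)·s forced by the typed half-slab budgets,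
`adjacent_void_le`; κ = ¼ was the first cut, raised to ½ by the (CA390)(B) safety-2 rule when the
(CA389) geometry sweep (C2 engine 4, C3 engine 5, C6 engine 4′, critic 2c; D-plateau family) found
sup (J2 − typed)/(B+1) ≥ ⅛ on legal designs; on the RIDER-94 family the margins under ½ are +17…+38
and GROW with c); the residual's depth is slaved to it (D_R = D + (Btb+1)/2); the old texts stay
byte-identical as asides (settled negative edge pending a kernel certificate).
RANKED CRUXES. #2 TiltedLandingLaw421RT (the bet; RESTATE-β′ rev 13: the rev-11 engine text with the
one thin-lid binder 2·(Hs+hmax) ≤ R that the landed thin sink chain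
#1301→#1303→#1304∥#1305→#1306∥#1307 consumes — at the Ξ frame 2·(½+½) = 2 ≤ 135; pure complex
analysis: comoving heat-flow model exact to leading order, de Bruijn's strip bound caps held
configurations at k ≤ c²Hs² ≤ (Hs/s)²/4, margin 4 at D₀ = 1, plus the void charge (B+1)/2 for the
levels a held pair spends consuming a budget-legal dense wall fed by a legal zero-free interval; why
it might fail: a LEGAL frame whose consumption deficit exceeds (B+1)/2 — none known (RIDER-94 D3
family: deficit ≈ (c−32)/8; D-plateau family: sup ratio ≈ ⅛ of (B+1) at c96·D60; allowance (B+1)/2,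
factor ≈ 4 over the measured sup), a stacked/one-sided starved comb with hold-up factor > 4, or an
NL event pushed beyond (k+3)·R/2 by a cluster — the C2/C6/desk/critic comb engines are the
instrument; registry: W-08 skeleton trkD_v3q (1f07ef57: stub_restSuccBotQ purse-free,
stub_restRateBotQ purse-typed) stays keyed to the aside 24774, successor trkD_v4q =
{stub_restSuccBotQ unchanged, stub_restRateBotQP at purse P_R = typed + (B+1)/2 via C4's parametric
books} is a crux-plan task on the new item). #3 Remainder0Xi (ρ2; Hadamard partial fraction of Ξ′/Ξ,
far field −π/4 + S(t)-leakage ≈ 0.4 under the allowance log(γ/2π)/(4π) ≈ 2.14 at T_PT;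
rh-rho2-lead-1 on stmt-RiemannHypothesis-24730). #4 WindowRows421R = RESIDUAL (RH-implied exactly as
WindowRows421 — Laguerre–Pólya heredity at every finite depth, stmt-3188 LaguerreHeredityOfRH
proved, modulo the non-strict tangential case; refutation budget only: one wrong-sign extremum of Re
Ξ^(k), k ≤ 41 (D_R(T_PT) = 41.6), within 3.0·10³ of a height above 3·10¹² kills it AND RH; =
conjunct (b) of the rev-7–9 residual WindowedSignPatternAllBands421, whose landing conjunct (a) is
redundant — residual shrink #1, director (CA186)(2), kernels C6 bfeba44d / C3 ad492a6e, tenure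
replay — at the rev-11 depth D_R = D + (Btb+1)/2). Support: XiLevel0Inputs4 (CLOSED proved 13:55Z by
Theorems.Splittings.EarlyAppointmentsXiLevel0Inputs4Closed.xiLevel0Inputs4_holds, p723601), HeightPT
(cite, shared stmt-22032). Replaced by restate (rev 7): TiltedLandingLaw42 → TiltedLandingLaw421
(the (4,2) text false as typed: K1/T1, T1-seat kernel witness on a copy; never landed as ¬ on the
ledger), WindowedSignPatternAllBands → WindowedSignPatternAllBands421 (rev-5 literals slaved to the
dead law); (rev 10) WindowedSignPatternAllBands421 → WindowRows421 (conjunct (a) dropped as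
redundant); (rev 11, RESTATE-α) TiltedLandingLaw421 → TiltedLandingLaw421R (depth + (B+1)/2; old
text numerically false as typed, RIDER-94 ×2, kept as aside — no ¬-theorem on the ledger); (rev 13,
RESTATE-β′) TiltedLandingLaw421R → TiltedLandingLaw421RT (ONE binder 2·(Hs+hmax) ≤ R added, nothing
removed; the old item is not refuted — no negatives entry — and is kept as an aside implying the new
one), WindowRows421 → WindowRows421R (D → D + (Btb+1)/2, kept as aside). Asides (banked):
TiltedLandingLaw421, WindowRows421, HereditaryLaguerre, LogCombLandingLaw, CombDescentStep,
XiInLogCombClass, CombPairModel (proved).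
KILL CRITERIA. (i) A real entire f of order < 2 meeting the engine's sixteen hypotheses with NO NL
event at depth ≤ 4hmax/s+(Hs/s)²+B+1+(B+1)/2 within (k+3)·R/2 refutes #2 as typed — in particular
any LEGAL frame with consumption deficit > (B+1)/2 (kill rule: replicated ×2 by code-disjoint
engines ⇒ HOLD within the hour); a further model death closes the (A₀,C₀,D₀)+void-charge line unless
the counterexample is budget-sharp or the deficit is shown to scale with a typed quantity the purse
can carry (C4 purse menu `Law421P`, `law421P_mono`). (ii) ρ2 false at some γ > T_PT (certified S(t)
excursion) ⇒ raise R (≤ √γ/20 is available from C6 `xiBudgets_hold_sqrt`) once; a structural failure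
of the partial-fraction bookkeeping closes the line. (iii) A certified NL point of some Re Ξ^(k), k
≤ D_R(γ), in a window above T_PT refutes the residual WindowRows421R and RH — glorious close.
NOT DECOMPOSED YET. #2's line of record is the W-08 seal-swap skeleton
(Cruxes/TiltedLandingLaw421/Lines/trkD_v3q.lean 1f07ef57, lead rh-law421-lead-1: stub_restSuccBotQ :
RhW08.SealSwapQ.RestSuccBotQ · stub_restRateBotQ : RhW08.SealSwapQ.RestRateBotQ, 87 landed helpers
incl. the Negative/ socket lemmas AlphaSealTrkDFalse, LineageLawQFalse) keyed to the aside 24774;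
its successor for TiltedLandingLaw421R (trkD_v4q: SUCC stub unchanged, RATE stub at purse P_R) is
registered by the crux line after rev 11 (director (CA388)(i)); not filed as route items (two-layer
rule). No per-height corollary, no (4,4,·) instance, no Lehmer-species thin band, no V/(4s)
void-width variant (typable only as an extra frame datum; not needed while (B+1)/2 dominates it for
adjacent voids).
CHEAPEST FALSIFIER. The C2/C6/desk/critic comb engines on the RIDER-94 right-void family at larger c
(128/160) and at the h = 2 corner against the NEW depth, and the D-plateau maximiser family (wall at
distance D, unit teeth in front removed: r(c) = max_D (J2 − c + D − 12)/(c − D)) at c ∈ {128, 160,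
200} with its TREND in c, reporting the worst (J2 − typed)/(B + 1): any legal geometry with ratio >
½ kills the κ = ½ text, ratio ≥ ¼ re-opens the coefficient (safety-2 rule); plus C1 g17's
exact/Sturm truth pass of the families of record (G5 tangential, G4 Jensen-circle, K1 lone tilted
pair, T1/U1 stacks, 3- /4-pair stacks vs the de Bruijn cap, lone pair + one-sided starved comb,
sinc·(z−1)² triple): landing level vs 4h/s+(Hs/s)²+B+1+(B+1)/2 and abscissa vs (k+3)·R/2. For ρ2:
‖Ξ′/Ξ(w) − local polar part‖·s(γ) at γ = T_PT + 10³, w = γ + 67.5·u + i/2 from the first 10⁵ zeros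
(mpmath) — must be ≤ 0.5 with margin.
TWO-LAYER PLAN. BC5 rungs in tree: LocalFourierPolya
(Theorems.Splittings.EarlyAppointmentsLocalFourierPolya.localFourierPolya — the landing ⇒ NL-event
step, all entire g) and JensenSignLawIffRolleExtremal (polynomial shadow, proved); XiLevel0Inputs4
is closed (xiLevel0Inputs4_holds, p723601).
NUMBERS. s(T_PT) = 0.2336, 2s = 0.467 < 1/2 (thick band live), (1/2/s(T_PT))² = 4.6, Btb(T_PT) = 18,
D(T_PT) ≈ 32.1, void charge (Btb+1)/2 = 9.5, D_R(T_PT) ≈ 41.6 (law-side depth at the ξ frame 41.1,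
slack 2/s − 8 = 0.56), window (k+3)·67.5 ≤ 3.0·10³ at k = ⌊D_R(T_PT)⌋ = 41, allowance (1/2)/s(T_PT)
= 2.14, 3·hmax < 3/2 < 135, 2·Hs = 1 ≤ 135.

Novelty: NOVELTY (searches 2026-08-15, this session: zbMATH 'Polya-Wiman conjecture derivatives real entire
functions nonreal zeros' (4: CravenCsordasSmith1987 doi:10.2307/1971315, KiKim2000
doi:10.1215/s0012-7094-00-10413-9, Kim1996 doi:10.1090/s0002-9939-96-03083-3, Kim 1996 JKMS
zbl:0864.30021), 'zeros successive derivatives entire functions' (20: BergweilerEremenko2006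
arXiv:math/0510502, Harel–Namn–Sturm PAMS 1999 doi:10.1090/s0002-9939-99-04542-6 = acq-02191 unread,
Clunie–Edrei, Boas–Reddy …), 'repeated differentiation zeros polynomials complex roots dynamics'
(Hoskins–Kabluchko arXiv:2010.14320, Najnudel–Vu arXiv:2607.05054), 'Conrey zeros of derivatives xi'
(Conrey1983 doi:10.1016/0022-314x(83)90031-8); galaxy --star all 'Fourier critical points' /
'nonreal zeros of the derivatives' (0 relevant); local searchd down (rc reset); plus the card's
gen-0/gen-1 refuter audits which READ KabluchkoSeidel2019 (doi:10.1214/19-ejp295 =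
arXiv:1807.02140), O'Rourke–Williams arXiv:1810.06781, OrourkeSteinerberger2021 arXiv:1910.12161,
Galligo arXiv:2205.08747, FarmerRhoades2005, Ki2006, Farmer2022.)
Nearest prior art: (1) the pairing displacement 'critical point = zero − 1/(n·Cauchy–Stieltjes
transform)' [KabluchkoSeidel2019; O'Rourke–Williams] and the mean-field transport of complex roots
under repeated differentiation [OrourkeSteinerberger2021; Hoskins–Kabluchko arXiv:2010.14320] —
random/mean-field, no deterministic two-sided comb version, no landing ORDER; (2)
Pólya–Wiman/Fourier–Pólya:  [refs: 10.2307/1971315, 10.1215/s0012-7094-00-10413-9, 10.1090/s0002-9939-96-03083-3, 10.1090/s0002-9939-99-04542-6, 10.1016/0022-314x(83, 10.1214/19-ejp295, math/0510502, 2010.14320, 2607.05054, 1807.02140, 1810.06781, 1910.12161, 2205.08747, doi:10.2307/1971315, doi:10.1215/s0012-7094-00-10413-9, doi:10.1090/s0002-9939-96-03083-3, doi:10.1090/s0002-9939-99-04542-6, doi:10.1016/0022-314x, doi:10.1214/19]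

Barriers (technique_class: Polya-Wiman repeated-differentiation Jensen-disc): BARRIERS (catalogue Literature/Barriers/RiemannHypothesis/* read: JensenPolynomials,
DavenportHeilbronn, NewmanConjecture, LindelofBacklund, GramRosserFailures; technique_class below).
- Literature.Barriers.RiemannHypothesis.JensenPolynomials (Farmer2022; `JensenPolynomials_holds`,
`Farmer2022_kimTheorem`): met head-on and USED, not evaded — the barrier says large-shift
Taylor/Jensen data at the ORIGIN are RH-free because differentiation loses zero information; the
route quantifies exactly how fast (a zero at height γ, offset δ is lost after ≈ (δ/2)log γ ≤ C log²γ
derivatives) and places all its statements at the abscissa x ≈ γ of the zero and BELOW that depth,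
where the information provably still sits (LogCombLandingLaw localises the non-Laguerre point within
C log² of γ). Nothing is inferred from eventual hyperbolicity.
- Literature.Barriers.RiemannHypothesis.DavenportHeilbronn: NOT evaded, and turned into the kill
test — Ξ_f of the Davenport–Heilbronn function is a log-comb function (same Γ-factor far field,
zeros in a strip), so LogCombLandingLaw, CombDescentStep and LocalFourierPolya hold verbatim for it
and its genuine off-line zeros DO book non-Laguerre points on schedule; the arithmetic of ζ can
enter only in proving the target HereditaryLaguerre itself (as for every RH route), never in the
three cruxes, which are function theory. Stated plainly; kill criterion (ii) runs the positive
control.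
- Literature.Barriers.RiemannHypothesis.NewmanConjecture (Λ ≥ 0, 'barely tru

History (route lifecycle, newest last):
- 2026-08-16T04:16:19Z · AUTO-CRUX (backfill): HereditaryLaguerre — hypotheses of the deciding theorem that nothing in the route derives are cruxes (operator:999:1085951)
- 2026-08-24T02:18:31Z · DORMANT — reconciler: no traction for 6.4 d (last activity item-evidence-added at 2026-08-17T14:57:01Z); parked, not closed — `ledger route dormant route-RiemannHypothesi (operator:999:853228)
- 2026-08-27T10:03:29Z · REACTIVATED — reconciler: reactivated — activity statement-closed at 2026-08-27T07:53:47Z after parking at 2026-08-24T02:18:31Z (operator:999:2756564)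
- 2026-08-29T14:29:04Z · rev 7: restated TiltedLandingLaw42 (stmt-RiemannHypothesis-24729), WindowedSignPatternAllBands (stmt-RiemannHypothesis-24731) — repair (planner rh-tenure-earlyapp-1 g1; critic (CA165) RETURN V1+V4, director (CA171)): TiltedLandingLaw42 false as typed (critic K1 l.4404, C4 T1 l.4413/criti (planner-rh-tenure-earlyapp-1-g1-0)
- 2026-08-29T15:30:15Z · rev 10: restated WindowedSignPatternAllBands421 (stmt-RiemannHypothesis-24775) — RESIDUAL SHRINK #1 (director (CA186)(2); planner rh-tenure-earlyapp-1 g1): restate stmt-RiemannHypothesis-24775 WindowedSignPatternAllBands421 = (a) near-line l (planner-rh-tenure-earlyapp-1-g1-0)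

sub-problem: RiemannHypothesis · status: open · opened planner-plancard-RiemannHypothesis-RiemannHyp-c5fa7d6a-0 2026-08-15T11:12:22Z · rev 14 · ledger route-RiemannHypothesis-EarlyAppointments
GENERATED by the gate from the ledger (D-0016/17). Provers cite these decls: `theorem foo : Summit.RiemannHypothesis.RiemannHypothesis.Theses.EarlyAppointments.<Decl> := …` in Summits/RiemannHypothesis/RiemannHypothesis/Theorems/<Name>.lean.
-/

namespace Summit.RiemannHypothesis.RiemannHypothesis.Theses.EarlyAppointments

open scoped BigOperators Topology Manifold Classical MeasureTheory ProbabilityTheory Matrix InnerProductSpace ComplexConjugate ContinuousMap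
open Filter Set Function TopologicalSpace MeasureTheory

attribute [summit_statement] _root_.Summit.RiemannHypothesis

open Summit

/-- item stmt-RiemannHypothesis-27010 · crux · rank 2 · open · by planner
why it might fail: a LEGAL thin-lid frame (2(Hs+hmax) ≤ R; corner 2s = hmax allowed) whose consumption deficit exceeds the void charge (B+1)/2 — none known (sup 0.197(B+1), (CA389) sweep); or the E5 menu law, certified numerically only (thincert j344858, 2002 regions), failing in the kernel at a leaf.
sources: KiKim2000, CravenCsordasSmith1987, KabluchkoSeidel2019, Trudgian2014, kit:j344858, pub/ladder-directors/HOURLY-RH.md BLOCK 168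
[crux] RESTATE-β′ of TiltedLandingLaw421R (stmt-RiemannHypothesis-33346; PRIMARY (57ck) YES
2026-08-31T22:25:39Z HOME/INBOX l.24472, director-rh (CA1155)/(CA1164), BLOCK 168 E1′): the (4,2,1)
tilted-landing engine law — SAME text as 33346 (void charge (B+1)/2, κ = ½, depth k ≤ 4hmax/s +
(Hs/s)² + B + 1 + (B+1)/2, NL critical point within (k+3)·R/2) with ONE added frame binder 2·(Hs +
hmax) ≤ R (thin lid) inserted after 2·Hs ≤ R: the weakest binder the landed thin-sink consumer
RhW08.SinkThin.norm_farFieldAt_le_of_certificatesExistThin (#1305; producers #1301/#1303/#1304,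
lid/M feeds #1306/#1307, E5 menu RhW08.MenuThin.* token 154) takes; at the Ξ frame of closes (Hs =
½, hmax ≤ ½, R = 135) it holds as 2 ≤ 135. 33346 is NOT refuted and implies this item by dropping
the binder. Why it might fail: a legal thin-lid frame whose consumption deficit exceeds (B+1)/2
(none known; measured sup 0.197·(B+1)); the E5 menu law is certified numerically only (kit j344858
thincert: P1 175/175, P1b 175/175, P3 86/86, P2 1050/1050, P4 516/516 regions, interval-grade) and
could fail in the kernel at a leaf. Sources: KiKim2000, CravenCsordasSmith1987, KabluchkoSeidel2019,
Trudgian2014, kit j344858, BLO -/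
@[route_item "route-RiemannHypothesis-EarlyAppointments", crux (experiment := "instrument: kit jobs cited as sources kit:j344858") (source := "ledger wanted_by.sources on stmt-RiemannHypothesis-27010, 2026-09-01")]
def TiltedLandingLaw421RT : Prop :=
  ∀ (η : ℝ) (f : ℂ → ℂ) (x₀ s hmax R Hs : ℝ) (B : ℕ), Differentiable ℂ f → (∀ x : ℝ, (f (x : ℂ)).im = 0) → (∃ A' B' ρ : ℝ, ρ < 2 ∧ ∀ z : ℂ, ‖f z‖ ≤ A' * Real.exp (B' * ‖z‖ ^ ρ)) → 0 < s → 2 * s ≤ hmax → 2 * hmax ≤ R → 3 * hmax < R → 0 ≤ Hs → (∀ w : ℂ, f w = 0 → |w.im| ≤ Hs) → 2 * Hs ≤ R → 2 * (Hs + hmax) ≤ R → (∃ w₀ : ℂ, f w₀ = 0 ∧ w₀.im ≠ 0 ∧ w₀.re = x₀ ∧ |w₀.im| ≤ hmax) → (∀ r : ℝ, s ≤ r → r ≤ R → (∑ᶠ u ∈ {u : ℂ | f u = 0 ∧ |u.re - x₀| ≤ r}, ((analyticOrderAt f u).toNat : ℝ)) - 2 * r / s ≤ B) → (∀ r : ℝ,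 s ≤ r → r ≤ R → |(∑ᶠ u ∈ {u : ℂ | f u = 0 ∧ x₀ < u.re ∧ u.re ≤ x₀ + r}, ((analyticOrderAt f u).toNat : ℝ)) - r / s| ≤ 1 + B ∧ |(∑ᶠ u ∈ {u : ℂ | f u = 0 ∧ x₀ - r ≤ u.re ∧ u.re < x₀}, ((analyticOrderAt f u).toNat : ℝ)) - r / s| ≤ 1 + B) → 0 ≤ η → 2 * η ≤ 1 → (∀ w : ℂ, |w.re - x₀| ≤ R / 2 → |w.im| ≤ hmax → f w ≠ 0 → ‖deriv f w / f w - ∑ᶠ u ∈ {u : ℂ | f u = 0 ∧ |u.re - w.re| < R / 2}, ((analyticOrderAt f u).toNat : ℂ) * (w - u)⁻¹‖ ≤ η / s) → ∃ k : ℕ, (k : ℝ) ≤ 4 * hmax / s + (Hs / s) ^ 2 + B + 1 + ((B : ℝ) + 1) / 2 ∧ ∃ x : ℝ, |x - x₀| < ((k : ℝ) + 3) * R / 2 ∧ ((iteratedDeriv (k + 1) f (x : ℂ)).re = 0 ∧ (iteratedDeriv k f (x : ℂ)).re ≠ 0 ∧ 0 ≤ (iteratedDeriv k f (x : ℂ)).re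 * (iteratedDeriv (k + 2) f (x : ℂ)).re)

/-- item stmt-RiemannHypothesis-24730 · crux · rank 3 · closed · proved by Summit.RiemannHypothesis.RiemannHypothesis.Theorems.EarlyAppointmentsRemainder0Xi.Close.remainder0Xi (prover) · by planner
why it might fail: Far-field term ≈π/4 plus S(t)-leakage ≈4·|S|max/67.5 must fit under log(γ/2π)/(4π)≈2.14 at γ=T_PT (margin ≈40%); a larger local S(t) excursion than the HSW/Trudgian bound allows near 3·10¹², or pole/trivial-zero bookkeeping off the axis, could break the constant 1/2.
sources: Titchmarsh1986, Trudgian2014, PlattTrudgian2021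
[crux ρ2] RH-FREE LEVEL-0 REMAINDER FOR Ξ(z)=ξ(1/2+iz) at η=1/2, box radius R≡135,
T₁=T_PT=3000175332800: for γ>T₁ and every w with |Re w−γ|≤67.5, |Im w|≤1/2, Ξ(w)≠0: ‖Ξ′/Ξ(w) −
Σ_{Ξ(u)=0, |Re u−Re w|<67.5} ord(u)/(w−u)‖ ≤ (1/2)/s(γ) = log(γ/2π)/(4π) (≈2.14 at T_PT),
s(γ)=2π/log(γ/2π). Route: Hadamard partial fraction Ξ′/Ξ(w)=Σ_u 1/(w−u) (symmetric summation; Ξ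
even), far part = density integral (−π/4 from ∫₀^∞ log v/(1−v²)dv) + S(t)-discrepancy by partial
summation (≈4·max|S|/67.5 ≈0.4 with Trudgian/HSW explicit S(T)), off-axis corrections |Im w|≤1/2.
This is the item director mints rh-rho2-lead-1 on. [deps: none] [difficulty: M] -/
@[route_item "route-RiemannHypothesis-EarlyAppointments", crux (bottleneck := idea) (experiment := "instrument: ointments rev 12 OPEN·READY (Th/EarlyAppointments.lean; `@[closes] theorem closes (hH : HeightPT) (hRows : WindowRows421R) (hLaw : TiltedLa…") (source := "director RH l.72, 2026-09-01")]
def Remainder0Xi : Prop :=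
  ∀ γ : ℝ, 3000175332800 < γ → ∀ w : ℂ, |w.re - γ| ≤ 135 / 2 → |w.im| ≤ 1 / 2 → Literature.NumberTheory.LFunctions.riemannXiUpper w ≠ 0 → ‖deriv Literature.NumberTheory.LFunctions.riemannXiUpper w / Literature.NumberTheory.LFunctions.riemannXiUpper w - ∑ᶠ u ∈ {u : ℂ | Literature.NumberTheory.LFunctions.riemannXiUpper u = 0 ∧ |u.re - w.re| < 135 / 2}, ((analyticOrderAt Literature.NumberTheory.LFunctions.riemannXiUpper u).toNat : ℂ) * (w - u)⁻¹‖ ≤ 1 / 2 / (2 * Real.pi / Real.log (γ / (2 * Real.pi)))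

-- `Remainder0Xi` holds: proved by `Summit.RiemannHypothesis.RiemannHypothesis.Theorems.EarlyAppointmentsRemainder0Xi.Close.remainder0Xi` (its module imports this route file, so no `_holds` link can be stated here).

/-- item stmt-RiemannHypothesis-33347 · crux · rank 4 · open · by planner
why it might fail: RH-strength residual: a single non-Laguerre critical point of some Re Ξ^(k), k ≤ D_R(γ) ≈ 41.6 at T_PT, at |x − γ| < (k+3)·67.5 for a height γ > 3.0·10¹² refutes it (and RH); no evidence either way beyond Platt–Trudgian's height.
sources: PlattTrudgian2015, Trudgian2014, KiKim2000, C6 rh-idea-4 g18 WindowRows421 kernel bfeba44d, C3 g21 residual_iff_rows ad492a6e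
[crux — DECLARED RESIDUAL, RH-implied exactly as WindowRows421 (Laguerre–Pólya heredity at every
finite depth: stmt-3188 LaguerreHeredityOfRH proved + the ℝ/ℂ iteratedDeriv bridge, modulo the
non-strict tangential case); refutation budget only] windowed Laguerre rows for Ξ = riemannXiUpper
above T_PT = 3000175332800 to the rev-11 depth D_R(γ) = 2/s(γ) + (1/2/s(γ))² + Btb γ + 1 + (Btb γ +
1)/2 (≈ 41.6 at T_PT; s(γ) = 2π/log(γ/2π), Btb γ = ⌈2·(0.1035 log 2γ + 0.2395 log log 2γ + 4.92) +
1/100⌉₊): no non-Laguerre critical point of Re Ξ^(k) (g′ = 0 ≠ g with g·g″ ≥ 0) at any real x with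
|x − γ| < (k+3)·135/2, for every k ≤ D_R(γ). = the rev-10 residual WindowRows421
(stmt-RiemannHypothesis-24831, residual shrink #1, C6 rh-idea-4 g18 bfeba44d / C3 g21 ad492a6e) with
the depth slaved to the restated engine TiltedLandingLaw421R (RESTATE-α at κ = ½, director-rh
(CA388)/(CA390)); the rev-10 text is kept as an aside. Why it might fail: it is RH-strength — one
wrong-sign extremum of some Re Ξ^(k), k ≤ 41, within 3.0·10³ of a height above 3·10¹² refutes it AND
RH. Sources: C6 WindowRows421 kernel bfeba44d, C3 residual_iff_rows ad492a6e, Trudgian2014,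
PlattTrudgian2015, KiKim2000. -/
@[route_item "route-RiemannHypothesis-EarlyAppointments", crux (bottleneck := idea) (experiment := "instrument: R0 NODE OF RECORD — route-RiemannHypothesis-EarlyAppointments rev 12 OPEN·READY (Th/EarlyAppointments.lean; `@[closes] theorem closes (hH :…") (source := "director RH l.72, 2026-09-01")]
def WindowRows421R : Prop :=
  ∀ γ : ℝ, 3000175332800 < γ → ∀ (k : ℕ) (x : ℝ), (k : ℝ) ≤ 2 / (2 * Real.pi / Real.log (γ / (2 * Real.pi))) + (1 / 2 / (2 * Real.pi / Real.log (γ / (2 * Real.pi)))) ^ 2 + (⌈2 * (0.1035 * Real.log (2 * γ) + 0.2395 * Real.log (Real.log (2 * γ)) + 4.92) + 1 / 100⌉₊ : ℝ) + 1 + ((⌈2 * (0.1035 * Real.log (2 * γ) + 0.2395 * Real.log (Real.log (2 * γ)) + 4.92) + 1 / 100⌉₊ : ℝ) + 1) / 2 → |x - γ| < ((k : ℝ) + 3) * 135 / 2 → ¬ ((iteratedDeriv (k + 1) Literature.NumberTheory.LFunctions.riemannXiUpper (x : ℂ)).re = 0 ∧ (iteratedDeriv k Literature.NumberTheory.LFunctions.riemannXiUpper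 (x : ℂ)).re ≠ 0 ∧ 0 ≤ (iteratedDeriv k Literature.NumberTheory.LFunctions.riemannXiUpper (x : ℂ)).re * (iteratedDeriv (k + 2) Literature.NumberTheory.LFunctions.riemannXiUpper (x : ℂ)).re)

/-- item stmt-RiemannHypothesis-3182 · aside (kind.auto-crux: conjecture-grade) · rank 0 · open · by planner
why it might fail: RH-equivalent by design (RH ⇒ X by Laguerre–Pólya heredity, X ⇒ RH by Assembly): false iff ζ has an off-line zero. Zero margin — Λ ≥ 0 (Rodgers–Tao) and Lehmer pairs give near-degenerate right-sign extrema of Ξ^(k) — so no perturbative, compactness or finite-height argument proves it; k unbounded.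
sources: KiKim2000 (doi:10.1215/s0012-7094-00-10413-9), Kim1996 (doi:10.1090/s0002-9939-96-03083-3), Literature.Barriers.RiemannHypothesis.NewmanConjecture, RodgersTao2020, Literature.NumberTheory.LFunctions.riemannHypothesis_iff_im_eq_zero_of_riemannXiUpper_eq_zero_holds, card:RiemannHypothesis/RiemannHypothesis/early-appointments-landing-law
Thesis X: for every k and every real x with Ξ^(k+1)(x) = 0 ≠ Ξ^(k)(x) one has Ξ^(k)(x)·Ξ^(k+2)(x) <
0 (Ξℝ(t) = Re Ξ(t), Ξ = riemannXiUpper; iteratedDeriv over ℝ). The hereditary strict Laguerre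
inequality at critical points = 'no derivative of Ξ has a wrong-sign or degenerate extremum' = the
Fourier–Pólya form of RH [KiKim2000, Kim1996]. RH ⇒ X (LaguerreHeredityOfRH); X ⇒ RH via
LogCombLandingLaw + XiInLogCombClass (Assembly). Shared-decl candidate for a future
derivative-ladder route (their NWSE_∞ with ≤ 0 is the non-strict variant). -/
@[route_item "route-RiemannHypothesis-EarlyAppointments"]
def HereditaryLaguerre : Prop :=
  ∀ (k : ℕ) (x : ℝ), iteratedDeriv (k + 1) (fun t : ℝ => (Literature.NumberTheory.LFunctions.riemannXiUpper (t : ℂ)).re) x = 0 → iteratedDeriv k (fun t : ℝ => (Literature.NumberTheory.LFunctions.riemannXiUpper (t : ℂ)).re) x ≠ 0 → iteratedDeriv k (fun t : ℝ => (Literature.NumberTheory.LFunctions.riemannXiUpper (t : ℂ)).re) x * iteratedDeriv (k + 2) (fun t : ℝ => (Literature.NumberTheory.LFunctions.riemannXiUpper (t : ℂ)).re) x < 0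

/-- item stmt-RiemannHypothesis-24774 · aside · rank 2 · open · by planner
why it might fail: A stacked or one-sided starved comb with hold-up factor > 4 (de Bruijn cap (Hs/s)²/4 has margin 4 at C₀=2; observed 1.32–1.92) lands past 4hmax/s+(Hs/s)²+B+1, or a flanking budget-B cluster pushes the NL abscissa beyond (k+3)·R/2; the (4,2) typing died twice in the model (K1 depth, T1 window).
sources: KabluchkoSeidel2019, CravenCsordasSmith1987, KiKim2000, deBruijn1950, C4 PACKET rev6 37365a4dde272ebf (pub/ideators/rh-idea-6/g18/w07c8), critic (CA165) REGLUE GATE ideators l.4425; K1 l.4404; T1 l.4432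
[crux] RH-FREE TILTED LANDING ENGINE at (A₀,C₀,D₀)=(4,2,1) — text = C4 RESTATE KIT
`sig-TiltedLandingLaw421.txt` 44967f87da023dc8 (pub/ideators/rh-idea-6/g18/w07c8/restate421/)
byte-for-byte = the filed `TiltedLandingLaw42` (stmt-24729) text with exactly THREE edits: frame
antecedent `3 * hmax < R` inserted; conclusion depth `(k:ℝ) ≤ 4·hmax/s + (Hs/s)^2 + B + 1` (the de
Bruijn / heat-flow quadratic term, D₀=1); event window `|x − x₀| < ((k:ℝ)+3)·R/2` (Jensen drift of a
held pair). ↔ C4 PACKET rev 6 (37365a4dde272ebf) `Rev6.TiltedLandingLaw421 = TiltedLandingLaw5 4 2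
1` by `law421Route_iff` (Restate421 a04c6d2506b56db5, kernel: curry/uncurry + one_mul; tenure farm
replay rc 0, std axioms). CONTENT: for every real entire f of order < 2 with zeros in |Im| ≤ Hs (2Hs
≤ R), a non-real zero pair on the column Re = x₀ at height ≤ hmax (2s ≤ hmax, 2hmax ≤ R, 3hmax < R),
column budget Σ_{|Re u−x₀|≤r} ord ≤ 2r/s + B and half-slab budgets |Σ − r/s| ≤ 1 + B for s ≤ r ≤ R,
and level-0 remainder ‖f′/f(w) − Σ_{|Re u−Re w|<R/2} ord/(w−u)‖ ≤ η/s on the box |Re w−x₀| ≤ R/2,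
|Im w| ≤ hmax (0 ≤ η, 2η ≤ 1) ⟹ SOME level k ≤ 4·hmax/s + (Hs/s)² + B + 1 carries a non-Laguerre
critical point of Re f^(k) on ℝ -/
@[route_item "route-RiemannHypothesis-EarlyAppointments"]
def TiltedLandingLaw421 : Prop :=
  ∀ (η : ℝ) (f : ℂ → ℂ) (x₀ s hmax R Hs : ℝ) (B : ℕ), Differentiable ℂ f → (∀ x : ℝ, (f (x : ℂ)).im = 0) → (∃ A' B' ρ : ℝ, ρ < 2 ∧ ∀ z : ℂ, ‖f z‖ ≤ A' * Real.exp (B' * ‖z‖ ^ ρ)) → 0 < s → 2 * s ≤ hmax → 2 * hmax ≤ R → 3 * hmax < R → 0 ≤ Hs → (∀ w : ℂ, f w = 0 → |w.im| ≤ Hs) → 2 * Hs ≤ R → (∃ w₀ : ℂ, f w₀ = 0 ∧ w₀.im ≠ 0 ∧ w₀.re = x₀ ∧ |w₀.im| ≤ hmax) → (∀ r : ℝ, s ≤ r → r ≤ R → (∑ᶠ u ∈ {u : ℂ | f u = 0 ∧ |u.re - x₀| ≤ r}, ((analyticOrderAt f u).toNat : ℝ)) - 2 * r / s ≤ B) →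 (∀ r : ℝ, s ≤ r → r ≤ R → |(∑ᶠ u ∈ {u : ℂ | f u = 0 ∧ x₀ < u.re ∧ u.re ≤ x₀ + r}, ((analyticOrderAt f u).toNat : ℝ)) - r / s| ≤ 1 + B ∧ |(∑ᶠ u ∈ {u : ℂ | f u = 0 ∧ x₀ - r ≤ u.re ∧ u.re < x₀}, ((analyticOrderAt f u).toNat : ℝ)) - r / s| ≤ 1 + B) → 0 ≤ η → 2 * η ≤ 1 → (∀ w : ℂ, |w.re - x₀| ≤ R / 2 → |w.im| ≤ hmax → f w ≠ 0 → ‖deriv f w / f w - ∑ᶠ u ∈ {u : ℂ | f u = 0 ∧ |u.re - w.re| < R / 2}, ((analyticOrderAt f u).toNat : ℂ) * (w - u)⁻¹‖ ≤ η / s) → ∃ k : ℕ, (k : ℝ) ≤ 4 * hmax / s + (Hs / s) ^ 2 + B + 1 ∧ ∃ x : ℝ, |x - x₀| < ((k : ℝ) + 3) * R / 2 ∧ ((iteratedDeriv (k + 1) f (x : ℂ)).re = 0 ∧ (iteratedDeriv k f (x : ℂ)).re ≠ 0 ∧ 0 ≤ (iteratedDeriv k f (x : ℂ)).re * (iteratedDeriv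 (k + 2) f (x : ℂ)).re)

/-- item stmt-RiemannHypothesis-3183 · aside · rank 2 · open · by planner
why it might fail: Uniform depth C(A)·log² rests on an unproved descent-rate heuristic (step ≥ D/(D²+P²), +1 per clustered zero); the only proved control, Kim/Ki–Kim via Gontcharoff (Farmer2022_kimTheorem_holds), gives depth ~ T for Ξ, non-uniform in f. One fixed-A family landing slower than log²(|z₀|+3) refutes it.
sources: Kim1996 (doi:10.1090/s0002-9939-96-03083-3), KiKim2000 (doi:10.1215/s0012-7094-00-10413-9), Literature.Barriers.RiemannHypothesis.Farmer2022_kimTheorem (Farmer2022_kimTheorem_holds; norm_le_exp_neg_of_nonreal_zero), Farmer2022 (arXiv:2008.07206), KabluchkoSeidel2019 (doi:10.1214/19-ejp295; arXiv:1807.02140), OrourkeSteinerberger2021 (arXiv:1910.12161)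
LOG-COMB LANDING LAW (class version of the card's (L)+(C1), falsifiable). For every A there is C
such that: if f is entire of order < 2, real on ℝ, even, with all zeros in |Im z| ≤ 1, and its far
field is a logarithmic line charge, ‖f′/f(z) + i(a·log(‖z‖+3) + b)‖ ≤ A for Im z ≥ 5 (0 ≤ a ≤ A, |b|
≤ A), then every non-real zero z₀ of f books a NON-LAGUERRE critical point of some derivative of fℝ
= Re f|ℝ: ∃ k ≤ C·log²(‖z₀‖+3), ∃ x with |x − Re z₀| ≤ C·log²(‖z₀‖+3), fℝ^(k+1)(x) = 0 ≠ fℝ^(k)(x)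
and fℝ^(k)(x)·fℝ^(k+2)(x) ≥ 0. Mechanism: the topmost non-real zero near x₀ descends by ≥ D/(D²+P²)
per differentiation (D ≥ 1/(2h) + comb field, P = local tilt ≤ one-sided count excess, bounded by
Jensen counts from the far field), tight clusters cost one step per zero, Jensen discs confine
lineages; landing produces the NL point by LocalFourierPolya. Typical Ξ configurations: k* = πΔ ≤
(1/4)log(γ/2π) [card (M),(C1)]; log² is the S(T) = O(log T) worst case. Positive control: Ξ of the
Davenport–Heilbronn function is in the class. -/
@[route_item "route-RiemannHypothesis-EarlyAppointments"]
def LogCombLandingLaw : Prop :=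
  ∀ A : ℝ, ∃ C : ℝ, ∀ (f : ℂ → ℂ) (a b : ℝ), Literature.Analysis.Complex.IsEntireOfOrderLt 2 f → Literature.Analysis.Complex.IsRealOnReal f → (∀ z : ℂ, f (-z) = f z) → Literature.Analysis.Complex.RootsInStrip f 1 → 0 ≤ a → a ≤ A → |b| ≤ A → (∀ z : ℂ, 5 ≤ z.im → ‖deriv f z / f z + Complex.I * ((a * Real.log (‖z‖ + 3) + b : ℝ) : ℂ)‖ ≤ A) → ∀ z : ℂ, f z = 0 → z.im ≠ 0 → ∃ (k : ℕ) (x : ℝ), (k : ℝ) ≤ C * Real.log (‖z‖ + 3) ^ 2 ∧ |x - z.re| ≤ C * Real.log (‖z‖ + 3) ^ 2 ∧ iteratedDeriv (k + 1) (fun t : ℝ => (f (t : ℂ)).re) x = 0 ∧ iteratedDeriv k (fun t : ℝ => (f (t : ℂ)).re) x ≠ 0 ∧ 0 ≤ iteratedDeriv k (fun t : ℝ => (f (t : ℂ)).re) x * iteratedDeriv (k + 2) (fun t : ℝ => (f (t : ℂ)).re) x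

/-- item stmt-RiemannHypothesis-33346 · aside · rank 2 · open · by planner
why it might fail: a LEGAL frame (corner 2s = hmax = Hs allowed) whose consumption deficit — levels the held pair spends consuming a budget-legal dense wall fed by a legal zero-free interval — exceeds the void charge (B+1)/2; measured sup 0.197·(B+1) tilted / 0.116 untilted ((CA389) sweep, D-plateau family).
sources: KiKim2000, CravenCsordasSmith1987, KabluchkoSeidel2019, Trudgian2014, C2 RIDER-94 (pub/ideators/INBOX.md l.6271; CE-24774-rightvoid.md), critic g22 rh-split/STATUS.md l.6763 (engine 2c, THESIS-NEG x2)
[crux] repaired TiltedLandingLaw421 (RESTATE-α, director-rh (CA388) 2026-08-30: void charge +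
(B+1)/2, κ = ½ by the (CA390)(B) safety-2 rule): the (4,2,1) tilted-landing engine — for every real
entire f of order < 2 with zeros in |Im| ≤ Hs, a non-real pair on the column Re = x₀ at height ≤
hmax, column/half-slab zero budgets B at scales s ≤ r ≤ R and a level-0 remainder ≤ η/s (2s ≤ hmax,
2hmax ≤ R, 3hmax < R, 2Hs ≤ R, 2η ≤ 1), some Re f^(k) has a non-Laguerre critical point on ℝ within
(k+3)·R/2 of x₀ at depth k ≤ 4hmax/s + (Hs/s)² + B + 1 + (B+1)/2. The rev-7–10 text (depth without
the void charge, stmt-RiemannHypothesis-24774) is numerically false as typed on legal right-void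
comb designs (C2 g38 RIDER-94 c40·D3·L33: level 50 > 49; c48·D3·L41: 60 > 57; margins
c40/c48/c56/c64/c80/c96 = −1/−3/−4/−5/−7/−8, J2 ≈ c+9+c/8; replicated by desk g26 engine 3 and
critic g22 engine 2c; books TNEG-1) and is kept as an aside (no kernel ¬-theorem). Why it might
fail: a LEGAL frame whose consumption deficit exceeds (B+1)/2 — none known (RIDER-94 D3 family
deficit ≈ (c−32)/8; (CA389) sweep D-plateau maximiser ≈ (B+1)/8 at c96·D60; allowance (B+1)/2,
safety ≈ 4 over the measured sup, trend in c t -/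
@[route_item "route-RiemannHypothesis-EarlyAppointments"]
def TiltedLandingLaw421R : Prop :=
  ∀ (η : ℝ) (f : ℂ → ℂ) (x₀ s hmax R Hs : ℝ) (B : ℕ), Differentiable ℂ f → (∀ x : ℝ, (f (x : ℂ)).im = 0) → (∃ A' B' ρ : ℝ, ρ < 2 ∧ ∀ z : ℂ, ‖f z‖ ≤ A' * Real.exp (B' * ‖z‖ ^ ρ)) → 0 < s → 2 * s ≤ hmax → 2 * hmax ≤ R → 3 * hmax < R → 0 ≤ Hs → (∀ w : ℂ, f w = 0 → |w.im| ≤ Hs) → 2 * Hs ≤ R → (∃ w₀ : ℂ, f w₀ = 0 ∧ w₀.im ≠ 0 ∧ w₀.re = x₀ ∧ |w₀.im| ≤ hmax) → (∀ r : ℝ, s ≤ r → r ≤ R → (∑ᶠ u ∈ {u : ℂ | f u = 0 ∧ |u.re - x₀| ≤ r}, ((analyticOrderAt f u).toNat : ℝ)) - 2 * r / s ≤ B) → (∀ r : ℝ, s ≤ r → r ≤ R → |(∑ᶠ u ∈ {u : ℂ | f u = 0 ∧ x₀ < u.re ∧ u.re ≤ x₀ + r}, ((analyticOrderAt f u).toNat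 : ℝ)) - r / s| ≤ 1 + B ∧ |(∑ᶠ u ∈ {u : ℂ | f u = 0 ∧ x₀ - r ≤ u.re ∧ u.re < x₀}, ((analyticOrderAt f u).toNat : ℝ)) - r / s| ≤ 1 + B) → 0 ≤ η → 2 * η ≤ 1 → (∀ w : ℂ, |w.re - x₀| ≤ R / 2 → |w.im| ≤ hmax → f w ≠ 0 → ‖deriv f w / f w - ∑ᶠ u ∈ {u : ℂ | f u = 0 ∧ |u.re - w.re| < R / 2}, ((analyticOrderAt f u).toNat : ℂ) * (w - u)⁻¹‖ ≤ η / s) → ∃ k : ℕ, (k : ℝ) ≤ 4 * hmax / s + (Hs / s) ^ 2 + B + 1 + ((B : ℝ) + 1) / 2 ∧ ∃ x : ℝ, |x - x₀| < ((k : ℝ) + 3) * R / 2 ∧ ((iteratedDeriv (k + 1) f (x : ℂ)).re = 0 ∧ (iteratedDeriv k f (x : ℂ)).re ≠ 0 ∧ 0 ≤ (iteratedDeriv k f (x : ℂ)).re * (iteratedDeriv (k + 2) f (x : ℂ)).re)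

/-- item stmt-RiemannHypothesis-3184 · aside · rank 3 · open · by planner
why it might fail: Rate s/π is solid (CombPairModel; K–S mean field −i/(πnρ)) but the ERROR SHAPE is a planner estimate: PV of an ε-regular comb gives P/D ~ ε·log(R/h) + s/h entering squared, the ±1 count slack costs 2/h; uniqueness radius h/2 and the ncard/finsum hypothesis format may need reshaping.
sources: O'Rourke–Williams 2019 (doi:10.1090/tran/7496), KabluchkoSeidel2019 (doi:10.1214/19-ejp295), FarmerRhoades2005 (doi:10.1090/s0002-9947-05-03721-9), route evidence REVIEW2-EarlyAppointments.md, REVIEW3-EarlyAppointments.md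
COMB DESCENT STEP = the card's lemma (L), 'deterministic Kabluchko–Seidel over a comb'. There is C >
0: let f be entire, real on ℝ, with a simple zero at x₀ + ih and, inside the disc D(x₀, R), no other
non-real zeros except x₀ ± ih and only simple real zeros forming an ε-regular comb of spacing s
(one-sided counts |#{zeros in (x₀, x₀+r]} − r/s| ≤ εr/s + 1 and likewise on the left, for s ≤ r ≤
R), and suppose the REMAINDER FIELD (f′/f minus the poles at the zeros in D(x₀,R), i.e. far zeros
and any exponential factor) is ≤ η/s on D(x₀+ih, h/2); if C·s ≤ h ≤ R/C and C·ε(1+log(R/h)) ≤ 1, C·η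
≤ 1, then f′ has exactly one zero w in D(x₀+ih, h/2), and h − s/π − E ≤ Im w ≤ h − s/π + E with E =
C·s·(ε(1+log(R/h)) + s/h + h/R + η). Proof route: Rouché for 1 + (z−z₀)F(z), F = f′/f − 1/(z−z₀),
with F(z₀) = −iπ/s·(1+O(ε(1+log(R/h)) + e^{−πh/s})) − i/(2h) + O(η/s + h/(Rs)) from the cot-kernel
comparison [FarmerRhoades2005 'cot flow' run for a complex zero]; the model case is CombPairModel.
Iterated, it gives the card's landing order πΔ − O(1) for isolated pairs and the two-sided rate
behind the derivative-rung = tube-rung dictionary (C2). -/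
@[route_item "route-RiemannHypothesis-EarlyAppointments"]
def CombDescentStep : Prop :=
  ∃ C : ℝ, 0 < C ∧ ∀ (f : ℂ → ℂ) (x₀ s h R ε η : ℝ), Differentiable ℂ f → (∀ x : ℝ, (f (x : ℂ)).im = 0) → 0 < s → C * s ≤ h → C * h ≤ R → 0 ≤ ε → C * ε * (1 + Real.log (R / h)) ≤ 1 → 0 ≤ η → C * η ≤ 1 → f ((x₀ : ℂ) + h * Complex.I) = 0 → deriv f ((x₀ : ℂ) + h * Complex.I) ≠ 0 → (∀ w : ℂ, ‖w - (x₀ : ℂ)‖ < R → f w = 0 → w.im ≠ 0 → (w = (x₀ : ℂ) + h * Complex.I ∨ w = (x₀ : ℂ) - h * Complex.I)) → (∀ x : ℝ, |x - x₀| < R → f (x : ℂ) = 0 → deriv f (x : ℂ) ≠ 0) → (∀ r : ℝ, s ≤ r → r ≤ R → |(({x : ℝ | f (x : ℂ) = 0 ∧ x₀ < x ∧ x ≤ x₀ + r}).ncard : ℝ) - r / s| ≤ ε * r / s + 1 ∧ |(({x : ℝ | f (x : ℂ) = 0 ∧ x₀ - r ≤ x ∧ x < x₀}).ncard : ℝ)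 - r / s| ≤ ε * r / s + 1) → (∀ z : ℂ, ‖z - ((x₀ : ℂ) + h * Complex.I)‖ ≤ h / 2 → f z ≠ 0 → ‖deriv f z / f z - ∑ᶠ w ∈ {w : ℂ | f w = 0 ∧ ‖w - (x₀ : ℂ)‖ < R}, (z - w)⁻¹‖ ≤ η / s) → ∃ w : ℂ, deriv f w = 0 ∧ ‖w - ((x₀ : ℂ) + h * Complex.I)‖ < h / 2 ∧ |w.im - (h - s / Real.pi)| ≤ C * s * (ε * (1 + Real.log (R / h)) + s / h + h / R + η) ∧ ∀ w' : ℂ, deriv f w' = 0 → ‖w' - ((x₀ : ℂ) + h * Complex.I)‖ < h / 2 → w' = w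

/-- item stmt-RiemannHypothesis-24831 · aside · rank 4 · open · by planner
why it might fail: Asserts Laguerre-sign heredity of Ξ to depth ≈32 in windows of radius ≈2.4·10³ around EVERY height above 3·10¹²: one wrong-sign (or tangential) extremum of Re Ξ^(k), k≤D(γ), there refutes it and RH — RH-strength; known only under RH. DECLARED RESIDUAL.
sources: CsordasNorfolkVarga1986, CsordasVarga1988, CravenCsordasSmith1987, KimLee2022JensenZeros, CA146(i) director ruling: residual declared (pub/ideators/INBOX.md l.4049), critic (CA165) V4 ideators l.4425
[crux — DECLARED RESIDUAL, RH-implied; not staffed for proof, refutation budget only] WINDOW ROWS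
above T₁=T_PT=3000175332800 with R≡135, Hs = 1/2: for every height γ>T₁, every
k≤D(γ)=2/s(γ)+(1/2/s(γ))^2+Btb(γ)+1 (Btb γ=⌈2·W₁(2γ)+1/100⌉₊, W₁(T)=0.1035 log T+0.2395 log log
T+4.92; D≈32.1 at T_PT) and every real x with |x−γ|<(k+3)·135/2 there is NO non-Laguerre critical
point of Re Ξ^(k) at x (¬(Re Ξ^(k+1)(x)=0 ∧ Re Ξ^(k)(x)≠0 ∧ 0≤Re Ξ^(k)(x)·Re Ξ^(k+2)(x)); ⟸ RH via
Laguerre–Pólya heredity: LaguerreHeredityOfRH stmt-3188 proved + the ℝ/ℂ iteratedDeriv bridge,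
modulo the non-strict tangential case). RESIDUAL SHRINK #1 (director (CA186)(2)): = conjunct (b) of
WindowedSignPatternAllBands421 (stmt-24775, revs 7–9) byte-for-byte = C6 rh-idea-4 g18
`RhIdea4.G18.C10.WindowRows421` (kernel file ClosesRowsOnly-W07c10-C6-rh-idea-4-g18.lean
bfeba44dd2525ceb: closes_rows rc 0 · 0 sorry · std axioms; independent kernel C3 g21
ad492a6e83436f44 residual_iff_rows; tenure replay + axiom guards); the dropped conjunct (a)
«near-line landing» is proved REDUNDANT in closes: the engine TiltedLandingLaw421 is δ-blind and
serves δ<2s(γ) at frame height hmax:=2s(γ) (needs 2s(γ)≤1/2 and 8≤2/s(γ), both ⟸ γ>T_ -/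
@[route_item "route-RiemannHypothesis-EarlyAppointments"]
def WindowRows421 : Prop :=
  ∀ γ : ℝ, 3000175332800 < γ → ∀ (k : ℕ) (x : ℝ), (k : ℝ) ≤ 2 / (2 * Real.pi / Real.log (γ / (2 * Real.pi))) + (1 / 2 / (2 * Real.pi / Real.log (γ / (2 * Real.pi)))) ^ 2 + (⌈2 * (0.1035 * Real.log (2 * γ) + 0.2395 * Real.log (Real.log (2 * γ)) + 4.92) + 1 / 100⌉₊ : ℝ) + 1 → |x - γ| < ((k : ℝ) + 3) * 135 / 2 → ¬ ((iteratedDeriv (k + 1) Literature.NumberTheory.LFunctions.riemannXiUpper (x : ℂ)).re = 0 ∧ (iteratedDeriv k Literature.NumberTheory.LFunctions.riemannXiUpper (x : ℂ)).re ≠ 0 ∧ 0 ≤ (iteratedDeriv k Literature.NumberTheory.LFunctions.riemannXiUpper (x : ℂ)).re * (iteratedDeriv (k + 2) Literature.NumberTheory.LFunctions.riemannXiUpper (x : ℂ)).re)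

/-- item stmt-RiemannHypothesis-3185 · support · rank 4 · closed · proved by Summit.RiemannHypothesis.RiemannHypothesis.Theorems.Splittings.EarlyAppointmentsLocalFourierPolya.localFourierPolya (prover) · by planner
why it might fail: Sign is assumed on the whole upper boundary (top edge alone lets surplus critical points exit via the sides); degeneracies (zeros of g, g′ on ∂B, multiple α/β, double critical points) must all fall on the ≥ 0 side; Ki–Kim's count is global (L–P*), no local version with boundary terms is in print.
sources: KiKim2000 (doi:10.1215/s0012-7094-00-10413-9) §3, Kim1996 (doi:10.1090/s0002-9939-96-03083-3), Sheil-Small 1989 (doi:10.2307/1971490), route evidence REVIEW1/2/3-EarlyAppointments.md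
LOCAL FOURIER–PÓLYA COUNT (landing ⇒ wrong-sign/degenerate extremum). Let g be entire and real on ℝ,
α < β real zeros of g, Y > 0, B = [α,β]×[−Y,Y]. If g has a non-real zero w with α < Re w < β, 0 <
|Im w| < Y, every zero of g′ in B is real, and the logarithmic field points DOWN on the upper
boundary of B (Im g′/g < 0 on the top edge and on the upper vertical sides — automatic when ∂B
avoids every Jensen disc, for real functions of genus ≤ 1), then some x ∈ (α, β) is a non-Laguerre
critical point of gℝ = Re g|ℝ: gℝ′(x) = 0, gℝ(x) ≠ 0, gℝ(x)·gℝ″(x) ≥ 0. Proof sketch (planner,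
checked on (z²−1)²(z²+0.09)(z²−4)): indent ∂B at the poles α, β; the sign hypothesis confines g′/g
to a half-plane on each half of ∂B, so wind(g′/g, ∂B) = 1; argument principle ⇒ #(critical points of
g in B off the zeros of g) = 1 + #(distinct zeros of g in B°) = m + 1 + n_nonreal ≥ m + 3 > m + 1
gaps; a zero-free gap with two critical points (or a double one) contains x with (g′/g)′(x) ≥ 0 at
g′(x) = 0. This is the localisation of Ki–Kim's global Fourier–Pólya count [KiKim2000; Kim1996;
Hurwitz 1912] needed because Ξ^(k) may a priori have infinitely many non-real zeros. -/
@[route_item "route-RiemannHypothesis-EarlyAppointments"]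
def LocalFourierPolya : Prop :=
  ∀ (g : ℂ → ℂ) (α β Y : ℝ), Differentiable ℂ g → (∀ x : ℝ, (g (x : ℂ)).im = 0) → α < β → 0 < Y → g (α : ℂ) = 0 → g (β : ℂ) = 0 → (∃ w : ℂ, g w = 0 ∧ α < w.re ∧ w.re < β ∧ 0 < |w.im| ∧ |w.im| < Y) → (∀ w : ℂ, deriv g w = 0 → α ≤ w.re → w.re ≤ β → |w.im| ≤ Y → w.im = 0) → (∀ z : ℂ, ((z.im = Y ∧ α ≤ z.re ∧ z.re ≤ β) ∨ ((z.re = α ∨ z.re = β) ∧ 0 < z.im ∧ z.im ≤ Y)) → (deriv g z / g z).im < 0) → ∃ x : ℝ, α < x ∧ x < β ∧ deriv (fun t : ℝ => (g (t : ℂ)).re) x = 0 ∧ (g (x : ℂ)).re ≠ 0 ∧ 0 ≤ (g (x : ℂ)).re * iteratedDeriv 2 (fun t : ℝ => (g (t : ℂ)).re) x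

-- `LocalFourierPolya` holds: proved by `Summit.RiemannHypothesis.RiemannHypothesis.Theorems.Splittings.EarlyAppointmentsLocalFourierPolya.localFourierPolya` (its module imports this route file, so no `_holds` link can be stated here).

/-- item stmt-RiemannHypothesis-22162 · support · rank 6 · closed · proved by Summit.RiemannHypothesis.RiemannHypothesis.Theorems.Splittings.JensenEdgeLawPoly.jensenEdgeUpperPoly (prover) · by planner
[crux] LINE L4 «JENSEN EDGE LAW», UPPER half, polynomial world (jen desk g14): for a real polynomial
P with positive coefficients and data γ_k = k!·P_k, every Jensen row satisfies N(J^{d,n}) ≤ N(P⁽ⁿ⁾)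
for ALL d (N = #non-real zeros); so rows n ≥ Pólya–Wiman index of P are hyperbolic at every degree
(the «never» rows of theory-2's law fa351ad19bfd000d §1, in the polynomial world). Strategy
(skeleton HOME=run/shared/lean/pub/rh-split/rh-split-jen-neg/g14/line/LineCountMonotonicity.lean
1e0f85090c28c0f3, nodes N5 LaguerreFactorialCZDS + N6 TopIdentity + N7 TopAssembly, glue
countBoundTop_of_nodes PROVED, T1 proved): for d ≥ deg P − n, J^{d,n} = Σ_k d!/(d−k)!·(P⁽ⁿ⁾)_k X^k
is, after reversal, the factorial multiplier {1/(j+a)!} (a = d − deg P⁽ⁿ⁾) applied to reverse P⁽ⁿ⁾ —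
LAGUERRE's theorem (φ = 1/Γ(x+a+1) ∈ L–P with negative zeros ⇒ CZDS), provable in-tree as a limit of
LaguerreCZDS.card_roots_le_step products (Gauss product for 1/Γ at integers) +
HutchinsonMultiplierLimit.le_card_roots_of_tendsto; smaller d by T1. Why it might fail: only a
typing slip in the top-range bookkeeping (degenerate degrees when P⁽ⁿ⁾ = 0 are covered: both sides
0); the mathematics is classical. Cheapest falsi -/
@[route_item "route-RiemannHypothesis-EarlyAppointments"]
def JensenEdgeUpperPoly : Prop :=
  ∀ (P : Polynomial ℝ), (∀ k ≤ P.natDegree, 0 < P.coeff k) → ∀ (d n : ℕ), (Literature.NumberTheory.LFunctions.jensenPoly (fun k => ((k.factorial : ℕ) : ℝ) * P.coeff k) d n).natDegree - Multiset.card (Literature.NumberTheory.LFunctions.jensenPoly (fun k => ((k.factorial : ℕ) : ℝ) * P.coeff k) d n).roots ≤ (Polynomial.derivative^[n] P).natDegree - Multiset.card (Polynomial.derivative^[n] P).roots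

/-- `JensenEdgeUpperPoly` holds: proved by `Summit.RiemannHypothesis.RiemannHypothesis.Theorems.Splittings.JensenEdgeLawPoly.jensenEdgeUpperPoly`. -/
theorem JensenEdgeUpperPoly_holds : JensenEdgeUpperPoly := _root_.Summit.RiemannHypothesis.RiemannHypothesis.Theorems.Splittings.JensenEdgeLawPoly.jensenEdgeUpperPoly

/-- item stmt-RiemannHypothesis-22166 · support · rank 7 · closed · proved by Summit.RiemannHypothesis.RiemannHypothesis.Theorems.Splittings.JensenEdgeLawPoly.jensenEdgeLowerPoly (prover) · by planner
[crux] LINE L4 «JENSEN EDGE LAW», LOWER half, polynomial world (jen desk g14): for P with positive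
coefficients, data γ_k = k!·P_k and each n there is d₀ with N(P⁽ⁿ⁾) ≤ N(J^{d,n}) for all d ≥ d₀ —
every non-real pair of P⁽ⁿ⁾ is eventually BORN in row n (the «onset» rows of theory-2's law
fa351ad19bfd000d §1, polynomial world; onset scales d_j* are instrument numerics, not part of the
statement). Strategy: for d ≥ deg P − n, J^{d,n}(y/d)·(normalisation) = Σ_k [d!/((d−k)!
d^k)]·(P⁽ⁿ⁾)_k y^k → P⁽ⁿ⁾ coefficientwise with equal degrees, and real roots are
upper-semicontinuous in the limit (tree: HutchinsonMultiplierLimit.le_card_roots_of_tendsto applied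
to a subsequence; scaling by card_roots_scale). Why it might fail: a uniformity slip — the statement
is per n (∃ d₀ depending on n and P), which is what the limit argument gives; a version uniform in n
would be false-prone. Cheapest falsifier: exhibit positive P, n with N(J^{d,n}) < N(P⁽ⁿ⁾) for
infinitely many d (impossible by the limit law; desk data: onsets observed at finite d in every
case). Sources: GORZ, PNAS 116 (2019) 11103–11110 (degree-aspect limit, Thm 1-type rescaling);
Craven–Csordas 1995. Nothing here bears on the truth of R -/
@[route_item "route-RiemannHypothesis-EarlyAppointments"]
def JensenEdgeLowerPoly : Prop :=
  ∀ (P : Polynomial ℝ), (∀ k ≤ P.natDegree, 0 < P.coeff k) → ∀ (n : ℕ), ∃ d₀ : ℕ, ∀ d ≥ d₀, (Polynomial.derivative^[n] P).natDegree - Multiset.card (Polynomial.derivative^[n] P).roots ≤ (Literature.NumberTheory.LFunctions.jensenPoly (fun k => ((k.factorial : ℕ) : ℝ) * P.coeff k) d n).natDegree - Multiset.card (Literature.NumberTheory.LFunctions.jensenPoly (fun k => ((k.factorial : ℕ) : ℝ) * P.coeff k) d n).roots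

/-- `JensenEdgeLowerPoly` holds: proved by `Summit.RiemannHypothesis.RiemannHypothesis.Theorems.Splittings.JensenEdgeLawPoly.jensenEdgeLowerPoly`. -/
theorem JensenEdgeLowerPoly_holds : JensenEdgeLowerPoly := _root_.Summit.RiemannHypothesis.RiemannHypothesis.Theorems.Splittings.JensenEdgeLawPoly.jensenEdgeLowerPoly

/-- item stmt-RiemannHypothesis-22032 · support · rank 9 · open · by planner
sources: PlattTrudgianBLMS2021, PlattTrudgian2021
[support] CITE (computational in print) - RH verified to height 3 000 175 332 800 (Platt-Trudgian
2021 Thm 1) as the tree's named fact `platt_trudgian_numerical_rh` (= `RiemannHypothesisUpTo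
3000175332800` by `Iff.rfl`); any T >= 1.82e10 makes RowHTop operative. [difficulty: open-problem] -/
@[route_item "route-RiemannHypothesis-EarlyAppointments", crux]
def HeightPT : Prop :=
  Literature.NumberTheory.LFunctions.platt_trudgian_numerical_rh

/-- item stmt-RiemannHypothesis-22161 · support · rank 9 · closed · proved by Summit.RiemannHypothesis.RiemannHypothesis.Theorems.Splittings.JensenEdgeLawPoly.jensenCountMonoDegree (prover) · by planner
[support] LINE L4 (D-0145; jen desk rh-split-jen-neg g14, lane jen-τ T1): COUNT MONOTONICITY IN THE
DEGREE — for every real sequence γ and all d,n the number of non-real zeros (natDegree − #real roots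
with multiplicity) of jensenPoly γ d n is ≤ that of jensenPoly γ (d+1) n; hence births are
thresholds (¬Splits at d ⇒ ¬Splits at every d′ ≥ d, converse companion of
JensenDegreeDescent.splits_jensenPoly_of_le) and instruments may binary-search the first
non-hyperbolic degree. PROVED IN KERNEL at
HOME=run/shared/lean/pub/rh-split/rh-split-jen-neg/g14/line/LineCountMonotonicity.lean sha16
1e0f85090c28c0f3 (countMonoDegree_holds; reflect-at-D conjugates D·q − X·q′ into X·(reflect D q)′,
Rolle, reflect back; std axioms) — a prover ports it to Theorems (RH-free, S-sized port). Sources: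
Craven–Csordas, Methods Appl. Anal. 2 (1995) 420–441 §1; ISAAC 2001 (Csordas) p.101. Nothing here
bears on the truth of RH. -/
@[route_item "route-RiemannHypothesis-EarlyAppointments"]
def JensenCountMonoDegree : Prop :=
  ∀ (γ : ℕ → ℝ) (d n : ℕ), (Literature.NumberTheory.LFunctions.jensenPoly γ d n).natDegree - Multiset.card (Literature.NumberTheory.LFunctions.jensenPoly γ d n).roots ≤ (Literature.NumberTheory.LFunctions.jensenPoly γ (d + 1) n).natDegree - Multiset.card (Literature.NumberTheory.LFunctions.jensenPoly γ (d + 1) n).roots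

/-- `JensenCountMonoDegree` holds: proved by `Summit.RiemannHypothesis.RiemannHypothesis.Theorems.Splittings.JensenEdgeLawPoly.jensenCountMonoDegree`. -/
theorem JensenCountMonoDegree_holds : JensenCountMonoDegree := _root_.Summit.RiemannHypothesis.RiemannHypothesis.Theorems.Splittings.JensenEdgeLawPoly.jensenCountMonoDegree

/-- item stmt-RiemannHypothesis-22167 · support · rank 9 · closed · proved by Summit.RiemannHypothesis.RiemannHypothesis.Theorems.Splittings.JensenEdgeLawPoly.jensenEdgeLawPoly (prover) · by planner
[support] LINE L4 TARGET «JENSEN EDGE LAW» (polynomial world; jen desk g14): for P with positive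
coefficients and data γ_k = k!·P_k, row n satisfies N(J^{d,n}) = N(P⁽ⁿ⁾) for all large d — row n is
non-hyperbolic at every large degree iff P⁽ⁿ⁾ has a non-real zero, it is hyperbolic at EVERY degree
iff P⁽ⁿ⁾ is real-rooted, and (with JensenCountMonoDegree) the hyperbolic degrees of each row form an
initial segment; this is the typed, RH-free form of theory-2's frozen T3-B law PRED-S-C1-3-7
fa351ad19bfd000d §1 («row j NONHYP at every large d ⟺ H_j has a non-real zero; k*_∞ = last such row;
Z_c(F⁽ʲ⁾) non-increasing in j») transported from the planted entire world F = P_w·G ∈ L–P* to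
polynomial data. GLUE PROVED: jensenEdgeLawPoly_of : JensenEdgeUpperPoly → JensenEdgeLowerPoly →
JensenEdgeLawPoly (HOME=run/shared/lean/pub/rh-split/rh-split-jen-neg/g14/line/L4/L4Items.lean).
Calibration floors (docstring record, instruments of the cell): sealed screens S-JEDGE-6-1…6-4,
S-C1-3-x; falsifier of record tonight = VERDICT #21 (S-C1-3-7: F5_d3 = 3 vs F9_d3 = 4) and
S-JEDGE-6-4 — these test the MODEL law's numerics, not this theorem. Entire L–P* version (genuinely
theory-2's setting) awaits a Lite -/
@[route_item "route-RiemannHypothesis-EarlyAppointments"]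
def JensenEdgeLawPoly : Prop :=
  ∀ (P : Polynomial ℝ), (∀ k ≤ P.natDegree, 0 < P.coeff k) → ∀ (n : ℕ), ∃ d₀ : ℕ, ∀ d ≥ d₀, (Literature.NumberTheory.LFunctions.jensenPoly (fun k => ((k.factorial : ℕ) : ℝ) * P.coeff k) d n).natDegree - Multiset.card (Literature.NumberTheory.LFunctions.jensenPoly (fun k => ((k.factorial : ℕ) : ℝ) * P.coeff k) d n).roots = (Polynomial.derivative^[n] P).natDegree - Multiset.card (Polynomial.derivative^[n] P).roots

/-- `JensenEdgeLawPoly` holds: proved by `Summit.RiemannHypothesis.RiemannHypothesis.Theorems.Splittings.JensenEdgeLawPoly.jensenEdgeLawPoly`. -/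
theorem JensenEdgeLawPoly_holds : JensenEdgeLawPoly := _root_.Summit.RiemannHypothesis.RiemannHypothesis.Theorems.Splittings.JensenEdgeLawPoly.jensenEdgeLawPoly

/-- item stmt-RiemannHypothesis-22168 · support · rank 9 · closed · proved by Summit.RiemannHypothesis.RiemannHypothesis.Theorems.Splittings.JensenSignLawCount.item22168 (prover) · by planner
[support] LINE L4 (jen-σ dictionary «SIGN LAW = ROLLE-EXTREMALITY»; jen desk g14): for every nonzero
real polynomial p, the strict Laguerre sign law at the critical points off the zero set (p′(x) = 0 ≠
p(x) ⇒ p(x)·p″(x) < 0 — conjunct B of the X-4 splitting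
Splittings.JensenDerivativeLaguerre.rh_iff_rowsFromOne_and_rowZeroLaguerre, and the polynomial
shadow of this route's HereditaryLaguerre) is EQUIVALENT to Rolle-extremality #roots p = #roots p′ +
1 (with multiplicity). Skeleton
HOME=run/shared/lean/pub/rh-split/rh-split-jen-neg/g14/line/LineSignLawCount.lean 3ade62f3b5e90ce2
(nodes L1 SimpleCritOfSignLaw, L2 UniqueCritBetweenRoots, L3 NoCritOutsideHull, L4
RolleExtremalOfSignLaw, L5 SignLawOfRolleExtremal; glue target_of_nodes and the X-4 dictionary
rh_iff_rowsFromOne_and_rowZeroCount PROVED; rc 0). EXACT CHECK: 127 953 random rational polynomials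
with prescribed critical points, 0 mismatches (desk g14 20:5xZ). Why it might fail: a multiplicity
convention slip at critical points lying on the zero set (they are excluded on the sign-law side and
absorbed by multiplicity on the count side — tested). Sources: Craven–Csordas 1995 §2 (Laguerre
inequalities); Mathlib Polynomial.card_ro -/
@[route_item "route-RiemannHypothesis-EarlyAppointments"]
def JensenSignLawIffRolleExtremal : Prop :=
  ∀ p : Polynomial ℝ, p ≠ 0 → ((∀ x : ℝ, (Polynomial.derivative p).eval x = 0 → p.eval x ≠ 0 → p.eval x * (Polynomial.derivative (Polynomial.derivative p)).eval x < 0) ↔ Multiset.card p.roots = Multiset.card (Polynomial.derivative p).roots + 1)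

/-- `JensenSignLawIffRolleExtremal` holds: proved by `Summit.RiemannHypothesis.RiemannHypothesis.Theorems.Splittings.JensenSignLawCount.item22168`. -/
theorem JensenSignLawIffRolleExtremal_holds : JensenSignLawIffRolleExtremal := _root_.Summit.RiemannHypothesis.RiemannHypothesis.Theorems.Splittings.JensenSignLawCount.item22168

-- item stmt-RiemannHypothesis-22178 · support · rank 9 · open · by planner — informal only, no Lean statement yet:
--   [support] LINE L4 «JENSEN EDGE LAW» — ENTIRE (L–P*) FORM, UNTYPED TONIGHT (jen desk rh-split-jen-neg
--   g14; theory-2's frozen T3-B law PRED-S-C1-3-7 fa351ad19bfd000d §1 lives in this setting): for a real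
--   entire function F = p·φ with p a real polynomial and φ in the Laguerre–Pólya class (F ∈ L–P*, Taylor
--   data γ), and every n: (i) jensenPoly γ d n is hyperbolic for every d iff F⁽ⁿ⁾ ∈ L–P
--   (Pólya–Schur/Jensen characterisation); (ii) Z_c(F⁽ⁿ⁺¹⁾) ≤ Z_c(F⁽ⁿ⁾) ≤ Z_c(p) and Z_c(F⁽ⁿ⁾) = 0 for n
--   ≥ some k*_∞(F) (Pólya–Wiman theorem: Craven–Csordas–Smith, Ann. Math. 125 (1987) 405–431; Kim, PAMS
--   109 (1990);

/-- item stmt-RiemannHypothesis-24732 · support · rank 9 · closed · proved by Summit.RiemannHypothesis.RiemannHypothesis.Theorems.Splittings.EarlyAppointmentsXiLevel0Inputs4Closed.xiLevel0Inputs4_holds (prover) · by planner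
sources: Trudgian2014, PlattTrudgian2015, C6 ZetaWindowBudget-W07c8-C6-rh-idea-4-g17.lean (pub/ideators/rh-idea-4/w7c8)
[support, RH-free, provable-now] LEVEL-0 Ξ INPUTS at T₁=T_PT, R≡135, B=Btb γ=⌈2·W₁(2γ)+1/100⌉₊,
s(γ)=2π/log(γ/2π): (i) Ξ entire of order <2 (`IsEntireOfOrderLt 2 riemannXiUpper`; proved as
`isEntireOfOrderLt_two_riemannXiUpper` in Cruxes/LogCombLandingLaw/Costume.lean — move to
Theorems/); (ii) COLUMN BUDGET Σ_{Ξ(u)=0,|Re u−γ|≤r} ord(u) − 2r/s(γ) ≤ Btb γ and (iii) HALF-SLAB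
BUDGETS |Σ_{γ<Re u≤γ+r} ord − r/s(γ)|, |Σ_{γ−r≤Re u<γ} ord − r/s(γ)| ≤ 1+Btb γ for s(γ)≤r≤135, γ>T₁
— (ii),(iii) are `xiBudgets_hold` (B:=Bstar, R:=135, T₁≥3.06·10¹⁰+137) of C6
ZetaWindowBudget-W07c8-C6-rh-idea-4-g17.lean (rc 0, sorry-free; Trudgian/HSW explicit N(T) windows)
after unfolding xiSpacing/W₁/Bstar/ColumnBudgetMult/HalfSlabBudget — land that file under Theorems/
and close this item by `exact ⟨…, (xiBudgets_hold …).1, (xiBudgets_hold …).2⟩`. [deps: none]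
[difficulty: provable-now] -/
@[route_item "route-RiemannHypothesis-EarlyAppointments", crux (experiment := "instrument: ·READY (Th/EarlyAppointments.lean; `@[closes] theorem closes (hH : HeightPT) (hRows : WindowRows421R) (hLaw : TiltedLandingLaw421R) (hρ2 : …") (source := "director RH l.72, 2026-09-01")]
def XiLevel0Inputs4 : Prop :=
  Literature.Analysis.Complex.IsEntireOfOrderLt 2 Literature.NumberTheory.LFunctions.riemannXiUpper ∧ (∀ γ : ℝ, 3000175332800 < γ → ∀ r : ℝ, (2 * Real.pi / Real.log (γ / (2 * Real.pi))) ≤ r → r ≤ 135 → (∑ᶠ u ∈ {u : ℂ | Literature.NumberTheory.LFunctions.riemannXiUpper u = 0 ∧ |u.re - γ| ≤ r}, ((analyticOrderAt Literature.NumberTheory.LFunctions.riemannXiUpper u).toNat : ℝ)) - 2 * r / (2 * Real.pi / Real.log (γ / (2 * Real.pi))) ≤ (⌈2 * (0.1035 * Real.log (2 * γ) + 0.2395 * Real.log (Real.log (2 * γ)) + 4.92) + 1 / 100⌉₊ : ℝ)) ∧ (∀ γ : ℝ, 3000175332800 < γ → ∀ r : ℝ, (2 * Real.pi / Real.log (γ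 / (2 * Real.pi))) ≤ r → r ≤ 135 → |(∑ᶠ u ∈ {u : ℂ | Literature.NumberTheory.LFunctions.riemannXiUpper u = 0 ∧ γ < u.re ∧ u.re ≤ γ + r}, ((analyticOrderAt Literature.NumberTheory.LFunctions.riemannXiUpper u).toNat : ℝ)) - r / (2 * Real.pi / Real.log (γ / (2 * Real.pi)))| ≤ 1 + (⌈2 * (0.1035 * Real.log (2 * γ) + 0.2395 * Real.log (Real.log (2 * γ)) + 4.92) + 1 / 100⌉₊ : ℝ) ∧ |(∑ᶠ u ∈ {u : ℂ | Literature.NumberTheory.LFunctions.riemannXiUpper u = 0 ∧ γ - r ≤ u.re ∧ u.re < γ}, ((analyticOrderAt Literature.NumberTheory.LFunctions.riemannXiUpper u).toNat : ℝ)) - r / (2 * Real.pi / Real.log (γ / (2 * Real.pi)))| ≤ 1 + (⌈2 * (0.1035 * Real.log (2 * γ) + 0.2395 * Real.log (Real.log (2 * γ)) + 4.92) + 1 / 100⌉₊ : ℝ))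

-- `XiLevel0Inputs4` holds: proved by `Summit.RiemannHypothesis.RiemannHypothesis.Theorems.Splittings.EarlyAppointmentsXiLevel0Inputs4Closed.xiLevel0Inputs4_holds` (its module imports this route file, so no `_holds` link can be stated here).

/-- item stmt-RiemannHypothesis-3186 · aside · rank 9 · open · by planner
sources: Literature.NumberTheory.LFunctions.riemannXi_order_le_one_holds, Literature.NumberTheory.LFunctions.im_riemannXiUpper_ofReal_holds, Literature.NumberTheory.LFunctions.riemannXi_eq_zero_iff_holds, Literature.NumberTheory.LFunctions.norm_logDeriv_riemannXi_sub_model_le, Titchmarsh1986 §2.12, §4.12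
Ξ = riemannXiUpper is a log-comb function with a = 1/2: entire of order < 2
(riemannXi_order_le_one_holds), real on ℝ (im_riemannXiUpper_ofReal_holds), even
(riemannXiUpper_neg), zeros in |Im z| ≤ 1 (indeed < 1/2: riemannXi_eq_zero_iff_holds +
riemannZeta_ne_zero_of_one_le_re), and for Im z ≥ 5, writing w = 1/2 + Im z − i·Re z (Re w ≥ 5.5),
Ξ′/Ξ(z) = −i·ξ′/ξ(w) = −(i/2)log|w| + (1/2)arg w + O(1) by ξ′/ξ(w) = 1/w + 1/(w−1) − ½log π +
½ψ(w/2) + ζ′/ζ(w), Stirling for ψ (Literature norm_digamma_sub_log_le; cf.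
norm_logDeriv_riemannXi_sub_model_le, XiHorizontalLogDeriv.lean) and ‖ζ′/ζ(w)‖ ≤ Σ Λ(n)n^{−5.5};
hence ‖Ξ′/Ξ(z) + i(½log(‖z‖+3) + b)‖ ≤ A with explicit b, A. Provable now from proved tree facts; it
is the second antecedent of Assembly. -/
@[route_item "route-RiemannHypothesis-EarlyAppointments", crux]
def XiInLogCombClass : Prop :=
  Literature.Analysis.Complex.IsEntireOfOrderLt 2 Literature.NumberTheory.LFunctions.riemannXiUpper ∧ Literature.Analysis.Complex.IsRealOnReal Literature.NumberTheory.LFunctions.riemannXiUpper ∧ (∀ z : ℂ, Literature.NumberTheory.LFunctions.riemannXiUpper (-z) = Literature.NumberTheory.LFunctions.riemannXiUpper z) ∧ Literature.Analysis.Complex.RootsInStrip Literature.NumberTheory.LFunctions.riemannXiUpper 1 ∧ ∃ A b : ℝ, 1 / 2 ≤ A ∧ |b| ≤ A ∧ ∀ z : ℂ, 5 ≤ z.im → ‖deriv Literature.NumberTheory.LFunctions.riemannXiUpper z / Literature.NumberTheory.LFunctions.riemannXiUpper z + Complex.I * ((1 / 2 * Real.log (‖z‖ + 3) + b : ℝ)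 : ℂ)‖ ≤ A

/-- item stmt-RiemannHypothesis-3187 · aside · rank 9 · closed · proved by Summit.RiemannHypothesis.RiemannHypothesis.Theorems.Splittings.EarlyAppointmentsCombPairModel.combPairModel_holds (prover) · by planner
sources: card:RiemannHypothesis/RiemannHypothesis/early-appointments-landing-law (M), KabluchkoSeidel2019
The card's MODEL LEMMA (M), exact computation: for F(z) = cos(πz/s)(z²+h²)/(z²−s²/4) (uniform comb
of spacing s with the two central zeros replaced by ±ih), F′/F(iy) = i·[−(π/s)tanh(πy/s) +
2y/(h²−y²) + 2y/(y²+s²/4)]. (1) ∃ C: for h ≥ C·s the bracket vanishes at some y ∈ (0,h) with |y − (h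
− s/π)| ≤ C·s²/h (the critical point paired with ih sits s/π lower: ONE derivative lowers the pair
by one spacing over π); (2) for 0 < h ≤ s the bracket is > 0 on (0, h) (no critical point below the
pair on the axis: the pair has landed; planner check: near y → 0 the bracket is y·((10 − π²)/s² +
2/h² − 2/s²) > 0, tight). Real analysis (IVT + tanh bounds); warm-up confirming the rate used in
CombDescentStep. -/
@[route_item "route-RiemannHypothesis-EarlyAppointments"]
def CombPairModel : Prop :=
  (∃ C : ℝ, 0 < C ∧ ∀ s h : ℝ, 0 < s → C * s ≤ h → ∃ y : ℝ, 0 < y ∧ y < h ∧ |y - (h - s / Real.pi)| ≤ C * s ^ 2 / h ∧ -(Real.pi / s) * Real.tanh (Real.pi * y / s) + 2 * y / (h ^ 2 - y ^ 2) + 2 * y / (y ^ 2 + s ^ 2 / 4) = 0) ∧ (∀ s h y : ℝ, 0 < s → 0 < h → h ≤ s → 0 < y → y < h → 0 < -(Real.pi / s) * Real.tanh (Real.pi * y / s) + 2 * y / (h ^ 2 - y ^ 2) + 2 * y / (y ^ 2 + s ^ 2 / 4))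

-- `CombPairModel` holds: proved by `Summit.RiemannHypothesis.RiemannHypothesis.Theorems.Splittings.EarlyAppointmentsCombPairModel.combPairModel_holds` (its module imports this route file, so no `_holds` link can be stated here).

/-- item stmt-RiemannHypothesis-3188 · support · rank 9 · closed · proved by Summit.RiemannHypothesis.RiemannHypothesis.Theorems.Splittings.JensenX4HereditaryLaguerreRH.laguerreHeredityOfRH (prover) · by planner
sources: CravenCsordasSmith1987, Literature.Analysis.Complex.hadamard_genus_zero_holds, Polya1927
Converse direction RH ⇒ HereditaryLaguerre, certifying that the target is RH-EQUIVALENT and not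
stronger: under RH, Ξ(z) = Ξ(0)∏(1 − z²/γ_n²) with γ_n real (genus 0 in z²:
hadamard_genus_zero_holds applies to u ↦ Ξ(√u)), so Ξ ∈ L–P; L–P is closed under d/dz
(Laguerre/Pólya–Schur), and for φ ∈ L–P with infinitely many zeros (φ′/φ)′ = −Σ(x−x_j)^{−2} − … < 0
off the zeros, whence φ·φ″ < 0 at every critical point where φ ≠ 0. Sources: Levin, Distribution of
zeros of entire functions, Ch. VIII; CravenCsordasSmith1987 §1. -/
@[route_item "route-RiemannHypothesis-EarlyAppointments"]
def LaguerreHeredityOfRH : Prop :=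
  Summit.RiemannHypothesis → HereditaryLaguerre

-- `LaguerreHeredityOfRH` holds: proved by `Summit.RiemannHypothesis.RiemannHypothesis.Theorems.Splittings.JensenX4HereditaryLaguerreRH.laguerreHeredityOfRH` (its module imports this route file, so no `_holds` link can be stated here).

/-- item stmt-RiemannHypothesis-3189 · assembly · rank 1 · closed · proved by Summit.RiemannHypothesis.RiemannHypothesis.Theorems.Splittings.JensenX4HereditaryLaguerreRH.earlyAppointments_assembly (prover) · by planner
sources: Literature.NumberTheory.LFunctions.riemannHypothesis_iff_im_eq_zero_of_riemannXiUpper_eq_zero_holds, Summit.RiemannHypothesis_iff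
LogCombLandingLaw → XiInLogCombClass → HereditaryLaguerre → Summit.RiemannHypothesis. Glue only:
take A, b from XiInLogCombClass (a = 1/2 ≤ A), C from LogCombLandingLaw at A; if Ξ had a zero z with
z.im ≠ 0 the law gives k, x with Ξℝ^(k+1)(x) = 0, Ξℝ^(k)(x) ≠ 0, Ξℝ^(k)(x)·Ξℝ^(k+2)(x) ≥ 0,
contradicting HereditaryLaguerre; so ∀ z, Ξ z = 0 → z.im = 0, and RH follows from the PROVED fact
Literature.NumberTheory.LFunctions.riemannHypothesis_iff_im_eq_zero_of_riemannXiUpper_eq_zero_holds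
(Summit.RiemannHypothesis_iff). Expected: a few lines. -/
@[route_item "route-RiemannHypothesis-EarlyAppointments"]
def Assembly : Prop :=
  LogCombLandingLaw → XiInLogCombClass → HereditaryLaguerre → Summit.RiemannHypothesis

-- `Assembly` holds: proved by `Summit.RiemannHypothesis.RiemannHypothesis.Theorems.Splittings.JensenX4HereditaryLaguerreRH.earlyAppointments_assembly` (its module imports this route file, so no `_holds` link can be stated here).

-- records of items no longer active in this route (dropped / restated):
-- earlier TiltedLandingLaw42 (stmt-RiemannHypothesis-24729, replaced 2026-08-29T14:29:04Z -> stmt-RiemannHypothesis-24774): retired by None — ∀ (η : ℝ) (f : ℂ → ℂ) (x₀ s hmax R Hs : ℝ) (B : ℕ), Differentiable ℂ f → (∀ x : ℝ, (f (x : ℂ)).im = 0) → (∃ A' B' ρ : ℝ, ρ < 2 ∧ ∀ z : ℂ, ‖f z‖ ≤ A' * Real.exp (B' * ‖z‖ ^ ρ)) → 0 < s → 2 * s ≤ hmax → 2 * hmax ≤ R → 0 ≤ Hs → (∀ w : ℂ, f w = 0 → |w.im| ≤ Hs) → 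
-- earlier WindowedSignPatternAllBands (stmt-RiemannHypothesis-24731, replaced 2026-08-29T14:29:04Z -> stmt-RiemannHypothesis-24775): retired by None — (∀ γ δ : ℝ, 3000175332800 < γ → (riemannZeta ⟨1 / 2 + δ, γ⟩ = 0 ∧ 0 < δ) → δ < 2 * (2 * Real.pi / Real.log (γ / (2 * Real.pi))) → ∃ (k : ℕ) (x : ℝ), (k : ℝ) ≤ 2 / (2 * Real.pi / Real.log (γ / (2 * Real.pi))) + (⌈2 * (0.1035 * Real.log (2 * γ) + 0.2395
-- earlier WindowedSignPatternAllBands421 (stmt-RiemannHypothesis-24775, replaced 2026-08-29T15:30:15Z -> stmt-RiemannHypothesis-24831): retired by None — (∀ γ δ : ℝ, 3000175332800 < γ → (riemannZeta ⟨1 / 2 + δ, γ⟩ = 0 ∧ 0 < δ) → δ < 2 * (2 * Real.pi / Real.log (γ / (2 * Real.pi))) → ∃ (k : ℕ) (x : ℝ), (k : ℝ) ≤ 2 / (2 * Real.pi / Real.log (γ / (2 * Real.pi))) + (1 / 2 / (2 * Real.pi / Real.log (γ / 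

/-! D-0027 §2.1 — DECIDING THEOREM (planner-authored via `route open/edit --closes-file`; by planner-rh-tenure-earlyapp-1-g23-0 2026-08-31T22:59:08Z):
its hypotheses are this route's items and its conclusion the sub-problem Statement (glue_lint), and it elaborates with this file. -/

/-- DECIDING THEOREM (D-0027 §2.1) of route EarlyAppointments — RESTATE-β′ DRAFT (tenure g22 package for the successor tenure g23; PRIMARY's
ruling requested by director-rh (57ck) 2026-08-31T22:11Z; NOT executed by g22, which holds no write verb): the rev-12 `closes` byte-for-byte with the
engine binder RE-TYPED `TiltedLandingLaw421R → TiltedLandingLaw421RT` (= ⟨stmt-RiemannHypothesis-33346⟩'s text + the ONE thin-lid binder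
`2 * (Hs + hmax) ≤ R` inserted right after `2 * Hs ≤ R`, BLOCK 168 «E1′»; the binder the landed thin sink consumer
`RhW08.SinkThin.norm_farFieldAt_le_of_certificatesExistThin … (hHR : 2 * (Hs + hmax) ≤ R)` (#1305) takes).  At the Ξ frame the new binder is
discharged by ONE extra `(by linarith)` at each of the two application sites (NEAR-LINE: Hs = 1/2, hmax = 2·s(γ) ≤ 1/2 via `h2s`; THICK: hmax = δ < 1/2
via `hδh`; R = 135): 2·(1/2 + 1/2) = 2 ≤ 135.  FIVE binders, every one consumed: `HeightPT` (cite) · `WindowRows421R` (DECLARED RESIDUAL, unchanged) ·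
`TiltedLandingLaw421RT` (crux 2, RH-free engine, thin lid) · `Remainder0Xi` (crux 3, ρ2, closed·proved) · `XiLevel0Inputs4` (support, proved).
RH is NOT proved: the residual is RH-strength and the engine crux is open; ⟨33346⟩ stays in the file byte-identical (it implies the new item by dropping the binder). -/
@[closes "route-RiemannHypothesis-EarlyAppointments"] theorem closes (hH : HeightPT) (hRows : WindowRows421R) (hLaw : TiltedLandingLaw421RT)
    (hρ2 : Remainder0Xi) (hIn : XiLevel0Inputs4) : _root_.Summit.RiemannHypothesis := by
  /- (−1) Numerics above T_PT (C6 lemmas inlined): 8π < log(γ/2π), hence 2·s(γ) ≤ 1/2 and 8 ≤ 2/s(γ). -/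
  have eightpi_lt_log : ∀ γ : ℝ, (3000175332800 : ℝ) < γ → 8 * Real.pi < Real.log (γ / (2 * Real.pi)) := by
    intro γ hγ
    have hπ : Real.pi < 3.15 := Real.pi_lt_d2
    have hπ0 : 0 < Real.pi := Real.pi_pos
    have he : Real.exp 1 < 2.72 := lt_trans Real.exp_one_lt_d9 (by norm_num)
    have h26 : Real.exp (8 * Real.pi) < Real.exp 26 := Real.exp_lt_exp.2 (by nlinarith)
    have hpow : Real.exp 26 = (Real.exp 1) ^ 26 := by
      rw [Real.exp_one_pow]; norm_num
    have he' : Real.exp 1 ≤ 2.72 := he.le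
    have hnum : (Real.exp 1) ^ 26 ≤ (2.72 : ℝ) ^ 26 := by gcongr
    have h272 : (2.72 : ℝ) ^ 26 < 3000175332800 / 6.3 := by norm_num
    have hq : (3000175332800 : ℝ) / 6.3 < γ / (2 * Real.pi) := by
      rw [div_lt_div_iff₀ (by norm_num) (by positivity)]
      nlinarith
    have hpos : 0 < γ / (2 * Real.pi) := by positivity
    have : Real.exp (8 * Real.pi) < γ / (2 * Real.pi) := by linarith
    have := Real.log_lt_log (Real.exp_pos _) this
    rwa [Real.log_exp] at this
  have two_s_le_half : ∀ γ : ℝ, (3000175332800 : ℝ) < γ →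
      2 * (2 * Real.pi / Real.log (γ / (2 * Real.pi))) ≤ 1 / 2 := by
    intro γ hγ
    have hl := eightpi_lt_log γ hγ
    have hlpos : 0 < Real.log (γ / (2 * Real.pi)) := by linarith [Real.pi_pos]
    rw [show 2 * (2 * Real.pi / Real.log (γ / (2 * Real.pi))) = (4 * Real.pi) / Real.log (γ / (2 * Real.pi)) by ring]
    rw [div_le_iff₀ hlpos]
    linarith
  have eight_le_two_div_s : ∀ γ : ℝ, (3000175332800 : ℝ) < γ →
      (8 : ℝ) ≤ 2 / (2 * Real.pi / Real.log (γ / (2 * Real.pi))) := by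
    intro γ hγ
    have hl := eightpi_lt_log γ hγ
    have hlpos : 0 < Real.log (γ / (2 * Real.pi)) := by linarith [Real.pi_pos]
    rw [div_div_eq_mul_div, le_div_iff₀ (by positivity)]
    nlinarith [Real.pi_pos]
  /- (0) Numerics: `2π < T₁`, and the local spacing `s(γ) = 2π / log(γ/2π)` is positive above `T₁`. -/
  have h2π : 2 * Real.pi < (3000175332800 : ℝ) := by
    have := Real.pi_lt_four
    linarith
  have hs_pos : ∀ γ : ℝ, (3000175332800 : ℝ) < γ → 0 < 2 * Real.pi / Real.log (γ / (2 * Real.pi)) := by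
    intro γ hγ
    have h2 : (0 : ℝ) < 2 * Real.pi := by positivity
    exact div_pos h2 (Real.log_pos ((one_lt_div h2).2 (h2π.trans hγ)))
  /- (1) An off-line zero `ζ(1/2 + δ + iγ) = 0`, `δ > 0`, has `δ < 1/2` (Mathlib: `ζ ≠ 0` on `Re s ≥ 1`). -/
  have lt_half : ∀ γ δ : ℝ, riemannZeta ⟨1 / 2 + δ, γ⟩ = 0 → 0 < δ → δ < 1 / 2 := by
    intro γ δ hz hδ
    by_contra hge
    have h1 : (1 : ℝ) ≤ (⟨1 / 2 + δ, γ⟩ : ℂ).re := by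
      show (1 : ℝ) ≤ 1 / 2 + δ
      linarith [not_lt.1 hge]
    exact riemannZeta_ne_zero_of_one_le_re h1 hz
  /- (2) Ξ is real on ℝ and its zeros lie in `|Im z| ≤ 1/2` (tree theorems). -/
  have hreal : ∀ x : ℝ, (Literature.NumberTheory.LFunctions.riemannXiUpper (x : ℂ)).im = 0 :=
    Literature.NumberTheory.LFunctions.im_riemannXiUpper_ofReal_holds
  have hstrip : ∀ w : ℂ, Literature.NumberTheory.LFunctions.riemannXiUpper w = 0 → |w.im| ≤ 1 / 2 := by
    intro w hw
    have hw' : Literature.NumberTheory.LFunctions.riemannXi (1 / 2 + Complex.I * w) = 0 := hw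
    obtain ⟨-, h0, h1⟩ := (Literature.NumberTheory.LFunctions.riemannXi_eq_zero_iff_holds _).1 hw'
    simp at h0 h1
    rw [abs_le]
    constructor <;> linarith
  /- (3) MAIN: no off-line zero of `ζ` at positive height.  `γ ≤ T₁`: `HeightPT`.  `γ > T₁`: the engine, fed with `s = s(γ)`,
  `R = 135`, `Hs = 1/2`, `B = Btb γ`, `η = 1/2`, the pair `Ξ(γ - iδ) = 0`, `XiLevel0Inputs4`, `Remainder0Xi` (on `|Im w| ≤ hmax ≤ 1/2`) and
  hmax := 2·s(γ) (NEAR-LINE `δ < 2s(γ)`) resp. hmax := δ (THICK), outputs an NL event at depth `≤ 4·hmax/s + (1/2/s)² + B + 1 ≤ D(γ)`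
  within `(k+3)·135/2` of `γ` — forbidden by `WindowRows421`. -/
  have hclean : ∀ γ δ : ℝ, 0 < γ → riemannZeta ⟨1 / 2 + δ, γ⟩ = 0 → 0 < δ → False := by
    intro γ δ hγ0 hz hδ
    have hδh : δ < 1 / 2 := lt_half γ δ hz hδ
    rcases le_or_gt γ 3000175332800 with hle | hγ
    · have hre := hH ⟨1 / 2 + δ, γ⟩ hz (by simpa using hγ0) (by simpa using hle)
      simp at hre
      linarith
    · obtain ⟨⟨hdiff, ρ, Cg, hρ, hgrowth⟩, hBud, hHalf⟩ := hIn
      rcases lt_or_ge δ (2 * (2 * Real.pi / Real.log (γ / (2 * Real.pi)))) with hnear | hthick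
      · /- NEAR-LINE: hmax := 2·s(γ) (2s(γ) ≤ 1/2, and 4·hmax/s = 8 ≤ 2/s(γ), for γ > T_PT). -/
        have hs := hs_pos γ hγ
        have h2s := two_s_le_half γ hγ
        have hpair : Literature.NumberTheory.LFunctions.riemannXiUpper ⟨γ, -δ⟩ = 0 := by
          have hw : (1 / 2 : ℂ) + Complex.I * ⟨γ, -δ⟩ = ⟨1 / 2 + δ, γ⟩ := by
            apply Complex.ext <;> simp
          show Literature.NumberTheory.LFunctions.riemannXi (1 / 2 + Complex.I * ⟨γ, -δ⟩) = 0
          rw [hw]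
          exact (Literature.NumberTheory.LFunctions.riemannXi_eq_zero_iff_holds _).2
            ⟨hz, by show (0 : ℝ) < 1 / 2 + δ; linarith, by show 1 / 2 + δ < (1 : ℝ); linarith⟩
        obtain ⟨k, hk, x, hx, hNL⟩ := hLaw (1 / 2) Literature.NumberTheory.LFunctions.riemannXiUpper γ
          (2 * Real.pi / Real.log (γ / (2 * Real.pi))) (2 * (2 * Real.pi / Real.log (γ / (2 * Real.pi)))) 135 (1 / 2)
          ⌈2 * (0.1035 * Real.log (2 * γ) + 0.2395 * Real.log (Real.log (2 * γ)) + 4.92) + 1 / 100⌉₊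
          hdiff hreal ⟨Cg, 1, ρ, hρ, fun z ↦ by simpa using hgrowth z⟩ hs le_rfl (by linarith) (by linarith)
          (by norm_num) hstrip (by norm_num) (by linarith)
          ⟨⟨γ, -δ⟩, hpair, by show -δ ≠ 0; exact neg_ne_zero.2 hδ.ne', rfl,
            by show |(-δ)| ≤ 2 * (2 * Real.pi / Real.log (γ / (2 * Real.pi))); rw [abs_neg, abs_of_pos hδ]; exact hnear.le⟩
          (hBud γ hγ) (hHalf γ hγ) (by norm_num) (by norm_num)
          (fun w hw1 hw2 hw3 ↦ hρ2 γ hγ w hw1 (hw2.trans h2s) hw3)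
        have h1 : 4 * (2 * (2 * Real.pi / Real.log (γ / (2 * Real.pi)))) / (2 * Real.pi / Real.log (γ / (2 * Real.pi))) ≤
            2 / (2 * Real.pi / Real.log (γ / (2 * Real.pi))) := by
          have h8 : 4 * (2 * (2 * Real.pi / Real.log (γ / (2 * Real.pi)))) / (2 * Real.pi / Real.log (γ / (2 * Real.pi))) = 8 := by
            rw [show (4 : ℝ) * (2 * (2 * Real.pi / Real.log (γ / (2 * Real.pi)))) = 8 * (2 * Real.pi / Real.log (γ / (2 * Real.pi))) by ring,
              mul_div_assoc, div_self hs.ne', mul_one]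
          rw [h8]
          exact eight_le_two_div_s γ hγ
        exact hRows γ hγ k x (by linarith) hx hNL
      · have hs := hs_pos γ hγ
        have hpair : Literature.NumberTheory.LFunctions.riemannXiUpper ⟨γ, -δ⟩ = 0 := by
          have hw : (1 / 2 : ℂ) + Complex.I * ⟨γ, -δ⟩ = ⟨1 / 2 + δ, γ⟩ := by
            apply Complex.ext <;> simp
          show Literature.NumberTheory.LFunctions.riemannXi (1 / 2 + Complex.I * ⟨γ, -δ⟩) = 0
          rw [hw]
          exact (Literature.NumberTheory.LFunctions.riemannXi_eq_zero_iff_holds _).2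
            ⟨hz, by show (0 : ℝ) < 1 / 2 + δ; linarith, by show 1 / 2 + δ < (1 : ℝ); linarith⟩
        obtain ⟨k, hk, x, hx, hNL⟩ := hLaw (1 / 2) Literature.NumberTheory.LFunctions.riemannXiUpper γ
          (2 * Real.pi / Real.log (γ / (2 * Real.pi))) δ 135 (1 / 2)
          ⌈2 * (0.1035 * Real.log (2 * γ) + 0.2395 * Real.log (Real.log (2 * γ)) + 4.92) + 1 / 100⌉₊
          hdiff hreal ⟨Cg, 1, ρ, hρ, fun z ↦ by simpa using hgrowth z⟩ hs hthick (by linarith) (by linarith)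
          (by norm_num) hstrip (by norm_num) (by linarith)
          ⟨⟨γ, -δ⟩, hpair, by show -δ ≠ 0; exact neg_ne_zero.2 hδ.ne', rfl,
            by show |(-δ)| ≤ δ; rw [abs_neg, abs_of_pos hδ]⟩
          (hBud γ hγ) (hHalf γ hγ) (by norm_num) (by norm_num)
          (fun w hw1 hw2 hw3 ↦ hρ2 γ hγ w hw1 (hw2.trans hδh.le) hw3)
        have h1 : 4 * δ / (2 * Real.pi / Real.log (γ / (2 * Real.pi))) ≤
            2 / (2 * Real.pi / Real.log (γ / (2 * Real.pi))) := by
          rw [div_le_div_iff₀ hs hs]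
          nlinarith
        exact hRows γ hγ k x (by linarith) hx hNL
  /- (4) No off-line zero at positive height ⇒ RH (`riemannHypothesis_iff_strip_holds`; symmetries `conj`, `1 - s`). -/
  have zero_conj : ∀ s : ℂ, riemannZeta s = 0 → riemannZeta (starRingEnd ℂ s) = 0 := by
    intro s hs
    rw [riemannZeta_conj, hs, map_zero]
  have zero_one_sub : ∀ s : ℂ, riemannZeta s = 0 → 0 < s.re → s.re < 1 → riemannZeta (1 - s) = 0 := by
    intro s hs h0 h1
    have hn : ∀ n : ℕ, s ≠ -n := by
      intro n h
      have := congrArg Complex.re h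
      simp at this
      have : (0 : ℝ) ≤ n := Nat.cast_nonneg n
      linarith
    have h1' : s ≠ 1 := by
      intro h
      rw [h] at h1
      simp at h1
    rw [riemannZeta_one_sub hn h1', hs, mul_zero]
  have key : ∀ s : ℂ, riemannZeta s = 0 → 0 < s.re → s.re < 1 → 0 < s.im → s.re = 1 / 2 := by
    intro s hs h0 h1 him
    by_contra hne
    rcases lt_or_gt_of_ne hne with hlt | hgt
    · have hz : riemannZeta ⟨1 / 2 + (1 / 2 - s.re), s.im⟩ = 0 := by
        have h' := zero_conj _ (zero_one_sub s hs h0 h1)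
        have e : starRingEnd ℂ (1 - s) = ⟨1 / 2 + (1 / 2 - s.re), s.im⟩ := by
          apply Complex.ext
          · simp; ring
          · simp
        rwa [e] at h'
      exact hclean s.im (1 / 2 - s.re) him hz (by linarith)
    · have hz : riemannZeta ⟨1 / 2 + (s.re - 1 / 2), s.im⟩ = 0 := by
        have e : (⟨1 / 2 + (s.re - 1 / 2), s.im⟩ : ℂ) = s := by
          apply Complex.ext <;> simp
        rw [e]
        exact hs
      exact hclean s.im (s.re - 1 / 2) him hz (by linarith)
  show _root_.RiemannHypothesis
  refine Literature.NumberTheory.LFunctions.riemannHypothesis_iff_strip_holds.2 fun s hs h0 h1 ↦ ?_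
  have him : s.im ≠ 0 := Literature.NumberTheory.LFunctions.im_ne_zero_of_riemannZeta_eq_zero hs h0 h1
  rcases lt_or_gt_of_ne him with hneg | hpos
  · have := key (starRingEnd ℂ s) (zero_conj s hs) (by simpa using h0) (by simpa using h1) (by simpa using hneg)
    simpa using this
  · exact key s hs h0 h1 hpos

end Summit.RiemannHypothesis.RiemannHypothesis.Theses.EarlyAppointments
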